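import Literature.NumberTheory.EllipticCurves.ManinConstantSemistableTwistProofs
import HarnessLib

/-!
# The Manin constant at a prime with a semistable twist: the sharp (Newton-polygon) ender
# (model-free; every `p`, every ramification; proofs only)

Topic `NumberTheory/EllipticCurves` (theorems only; no definition, no named fact). In support of
the named fact `Literature.NumberTheory.EllipticCurves.edixhoven_int_of_neronLattice_eq_smul_periodLattice`
(Edixhoven 1991, Prop. 2: `c_f ∈ ℤ`). `ManinConstantSemistableTwistProofs` reduced the fact at an
ADDITIVE prime `p` to exhibiting, over the ring of integers `O = 𝒪_K` of a finite `K/ℚ_p` with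
`‖π‖ᵉ = p⁻¹`, a twist `V'' = (πᵏ, r, s, t) • (W' ⊗ K)` of FINITE HEIGHT — under the restriction
`k < e`. That restriction fails for the commonest additive types at `2` (a quadratic twist by `-1`
of a curve with good reduction at `2` has `ord₂ Δ_min = 12`, `k = e`). This file removes it:

* `norm_coeff_mul_pow_le_of_subst_eq_rescale` — **the Newton-polygon bound** (pure algebra over
  an ultrametric field): if `Φ ∈ XK⟦X⟧` has bounded coefficients whose maximum norm `M ≤ 1` is
  attained, `B ∈ XK⟦X⟧` has integral coefficients and a coefficient of norm `1` in degree `J`,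
  and `B(Φ(X)) = Φ(cX)`, then `‖b_j‖ Mʲ ≤ ‖c‖ M` for every `j ≥ 1`; in particular
  `M^{J-1} ≤ ‖c‖`. (For `B = [p]_F` and `Φ = exp_F(μX)` an integral homomorphism `𝔾_a → F`:
  `v(μ) ≥ v(p)/(J-1)`, and `v(μ) ≥ v(p) - v(b_j)` from any intermediate vertex.)
* `exists_index_norm_coeff_max` — over the discrete valuation ring `𝒪_K` the maximum is attained.
* `Padic.norm_le_one_of_pow_mul_pow_mul_norm_pow_le` (`…_of_pow_mul_norm_pow_le`) —
  `‖π‖ᵛ(‖π‖ᵏ‖u‖)^{j-1} ≤ p⁻¹`, `‖π‖ᵉ = p⁻¹`, `(j-1)k + v < je`, `u ∈ ℚ_p` force `‖u‖ ≤ 1`.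
* `exists_integral_param_of_semistableTwist` — the LOCAL Steps 5–9 of the capstone in isolation:
  the integral parameter `t₃ = θ(t₀) ∈ O⟦X⟧` with `[X¹]t₃ = πᵏu`, `log_{V''} t₃ = πᵏu·ℓ`.
* `padicNorm_le_one_of_integral_param` — **Step 10, the ender**: from such a `t₃`, finite
  height, and a vertex `(j, v)` (`‖b_j‖ ≥ ‖π‖ᵛ`, `(j-1)k + v < je`): `‖u‖_p ≤ 1`.
* `exists_formalParam_of_neronLattice_eq_smul_periodLattice` — the GLOBAL half of the capstone in
  isolation: from the data of the fact, a rational `u > 0` with `u = ±q` and a parameter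
  `t₀ ∈ Xℚ⟦X⟧ ∩ Frac ℤ⟦X⟧` of `W'` with `w_{W'}(t₀) ∈ Frac ℤ⟦X⟧`, `[X¹]t₀ = u`,
  `log_{W'}(t₀) = u·Σ aₙ(W')Xⁿ/n` (Steps 1–4 of `ManinConstantSemistableTwistProofs`).
* `padicNorm_le_one_of_formalLog_subst_eq_of_semistableTwist_vertex` / `…_sharp` — **the local
  half with `k < e` replaced by a vertex condition `(j - 1)k + v < je`** (`‖b_j‖ ≥ ‖π‖ᵛ`; the
  `_sharp` form is `v = 0`, `j = J` a degree with a unit coefficient: `(J - 1)k < Je`), at a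
  prime where `Σ aₙXⁿ/n` is `p`-integral (every additive prime): after the local lemma gives
  `t'' = θ(t₀) ∈ O⟦q⟧`, the series `Φ = t'' ∘ ℓ⁻¹ = exp_{V''}(πᵏuX) ∈ O⟦X⟧`
  (`ℓ⁻¹ ∈ ℤ_p⟦X⟧` by `PowerSeries.substInvOfIsUnit`) satisfies `[p]_{V''}(Φ) = Φ(pX)`
  (logarithms), so the Newton-polygon bound gives `‖b_j‖ ‖πᵏu‖^{j-1} ≤ p⁻¹`.
* `padicNorm_le_one_of_neronLattice_eq_smul_periodLattice_of_semistableTwist_vertex` / `…_sharp`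
  — the same for the data of the fact at an additive prime (Honda witness and `p`-integrality of
  `ℓ` are free there: `CuspidalReductionInfiniteHeightProofs`,
  `AdditiveReductionSemistableModelProofs`).

With `J = p^h` (`h` the height of `V'' ⊗ k_K`) the condition reads `k/e < 1 + 1/(p^h - 1)`; by
the tables of `KodairaDiscriminantValuesTwoProofs` (`ord₂ Δ_min ≤ 15` on the branches
`II, …, II*`) and `ord₃ Δ_min ≤ 13`, this covers every potentially good type at `3` and at `2`
outside `Iₙ*`, and every potentially multiplicative type (`J = 2`, `k/e = ord(c₄)/4 < 2`); the
remaining `Iₙ*` branches at `2` (`ord₂ c₄ = 6`, `ord₂ Δ_min ∈ {16, 17, 18}`) need the vertex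
`(2, v(a₁''))` of `[2]_{V''} = 2X - a₁''X² - …` (`a₁''⁴ ≡ c₄'' (mod 8)`, `v_K(c₄'') = e·ord₂(j)/3`),
which the `_vertex` forms provide. What is left for the fact at `2, 3` is thus LOCAL ALGEBRA
only: the semistable twists themselves (Kraus 1990).

## References

* B. Edixhoven, *On the Manin constants of modular elliptic curves*, in: Arithmetic Algebraic
  Geometry (Texel, 1989), Progr. Math. 89 (1991), 25–39, Prop. 2. [EdixhovenManin1991]
* T. Honda, *On the theory of commutative formal groups*, J. Math. Soc. Japan 22 (1970), 213–246,
  Thm. 2 (p. 223) (the type of a formal group; `𝔾_a`-type at infinite height). [Honda1970]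
* J. Lubin, *One-parameter formal Lie groups over `p`-adic integer rings*, Ann. of Math. 80
  (1964), 464–484, §1 (Newton polygon of `[p]`, valuations of torsion points). [folklore]
* A. Kraus, *Sur le défaut de semi-stabilité des courbes elliptiques à réduction additive*,
  Manuscripta Math. 69 (1990), 353–385.
* J. H. Silverman, *The Arithmetic of Elliptic Curves*, 2nd ed. (2009), IV.2–IV.7, VII.2.
  [SilvermanAEC2009]
-/

noncomputable section

namespace Literature.NumberTheory.EllipticCurves

open PowerSeries

section Ultrametric

variable {K : Type*} [NormedField K] [IsUltrametricDist K]

/-- Coefficients of a product are bounded by the product of the bounds (ultrametric Cauchy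
product). [folklore] -/
theorem norm_coeff_mul_le_of_forall_le {f g : K⟦X⟧} {a b : ℝ}
    (hf : ∀ n, ‖coeff n f‖ ≤ a) (hg : ∀ n, ‖coeff n g‖ ≤ b) (n : ℕ) :
    ‖coeff n (f * g)‖ ≤ a * b := by
  have ha : 0 ≤ a := (norm_nonneg _).trans (hf 0)
  have hb : 0 ≤ b := (norm_nonneg _).trans (hg 0)
  rw [coeff_mul]
  refine IsUltrametricDist.norm_sum_le_of_forall_le_of_nonneg (mul_nonneg ha hb) fun x _ ↦ ?_
  rw [norm_mul]
  exact mul_le_mul (hf _) (hg _) (norm_nonneg _) ha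

/-- Coefficients of a power. [folklore] -/
theorem norm_coeff_pow_le_of_forall_le {f : K⟦X⟧} {a : ℝ}
    (hf : ∀ n, ‖coeff n f‖ ≤ a) (j n : ℕ) : ‖coeff n (f ^ j)‖ ≤ a ^ j := by
  induction j generalizing n with
  | zero =>
    rw [pow_zero, pow_zero, coeff_one]
    split_ifs
    · rw [norm_one]
    · rw [norm_zero]; exact zero_le_one
  | succ j ih =>
    rw [pow_succ, pow_succ]
    exact norm_coeff_mul_le_of_forall_le ih hf n

/-- Coefficients of a finite sum. [folklore] -/
theorem norm_coeff_sum_le_of_forall_le {ι : Type*} {s : Finset ι} {f : ι → K⟦X⟧} {a : ℝ}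
    (ha : 0 ≤ a) (hf : ∀ i ∈ s, ∀ n, ‖coeff n (f i)‖ ≤ a) (n : ℕ) :
    ‖coeff n (∑ i ∈ s, f i)‖ ≤ a := by
  rw [map_sum]
  exact IsUltrametricDist.norm_sum_le_of_forall_le_of_nonneg ha fun i hi ↦ hf i hi n

/-- In an ultrametric group, `‖x - a‖ < ‖a‖` forces `‖x‖ = ‖a‖`. [folklore] -/
theorem norm_eq_of_norm_sub_lt' {x a : K} (h : ‖x - a‖ < ‖a‖) : ‖x‖ = ‖a‖ := by
  have hx : x = a + (x - a) := by ring
  rw [hx, IsUltrametricDist.norm_add_eq_max_of_norm_ne_norm (ne_of_gt h), max_eq_left h.le]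

/-- **The Newton-polygon bound for an integral homomorphism `𝔾_a → F`.** Let `K` be an
ultrametric normed field, `Φ ∈ XK⟦X⟧` a series whose coefficient norms attain their maximum
`M ≤ 1` first at the index `n₁`, and `B ∈ XK⟦X⟧` a series with coefficients of norm `≤ 1` and a
coefficient of norm `1` in degree `J ≥ 1`; if `B(Φ(X)) = Φ(cX)` with `‖c‖ ≤ 1`, then
`‖b_j‖ Mʲ ≤ ‖c‖ M` for every `j ≥ 1` — in particular `M^{J-1} ≤ ‖c‖`. (Applied to `B = [p]_F`,
`Φ(X) = exp_F(μX)`, `c = p`: the valuations of the coefficients of an integral homomorphism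
`𝔾_a → F` into a formal group of finite height are at least `v(p)/(J - 1)`, and at least
`v(p) - v(b_j)` scaled, for each `j`.) [folklore] -/
theorem norm_coeff_mul_pow_le_of_subst_eq_rescale {Φ B : K⟦X⟧} {c : K} {n₁ J : ℕ}
    (hΦ0 : constantCoeff Φ = 0) (hΦ1 : ∀ n, ‖coeff n Φ‖ ≤ ‖coeff n₁ Φ‖)
    (hlow : ∀ n < n₁, ‖coeff n Φ‖ < ‖coeff n₁ Φ‖) (hne : coeff n₁ Φ ≠ 0)
    (hM1 : ‖coeff n₁ Φ‖ ≤ 1) (hB0 : constantCoeff B = 0) (hB : ∀ j, ‖coeff j B‖ ≤ 1)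
    (hJ : 1 ≤ J) (hBJ : ‖coeff J B‖ = 1) (hc : ‖c‖ ≤ 1) (heq : B.subst Φ = rescale c Φ)
    (j : ℕ) (hj : 1 ≤ j) : ‖coeff j B‖ * ‖coeff n₁ Φ‖ ^ j ≤ ‖c‖ * ‖coeff n₁ Φ‖ := by
  classical
  set M := ‖coeff n₁ Φ‖ with hM
  have hMpos : 0 < M := norm_pos_iff.mpr hne
  have hn₁ : 1 ≤ n₁ := by
    rcases Nat.eq_zero_or_pos n₁ with h | h
    · exfalso; apply hne; rw [h, coeff_zero_eq_constantCoeff_apply, hΦ0]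
    · exact h
  -- `M'` bounds the coefficients below `n₁`
  obtain ⟨n₀, hn₀, hn₀max⟩ := Finset.exists_max_image (Finset.range n₁) (fun n ↦ ‖coeff n Φ‖)
    ⟨0, Finset.mem_range.mpr hn₁⟩
  set M' : ℝ := ‖coeff n₀ Φ‖ with hM'
  have hM'0 : 0 ≤ M' := norm_nonneg _
  have hM'lt : M' < M := hlow n₀ (Finset.mem_range.mp hn₀)
  have hlowM' : ∀ n < n₁, ‖coeff n Φ‖ ≤ M' := fun n hn ↦ hn₀max n (Finset.mem_range.mpr hn)
  -- `Φ = Φ₁ + X^{n₁} G`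
  set G : K⟦X⟧ := PowerSeries.mk fun i ↦ coeff (n₁ + i) Φ with hG
  set Φ₂ : K⟦X⟧ := X ^ n₁ * G with hΦ₂
  set Φ₁ : K⟦X⟧ := Φ - Φ₂ with hΦ₁
  have hcΦ₂ : ∀ n, coeff n Φ₂ = if n₁ ≤ n then coeff n Φ else 0 := by
    intro n
    rw [hΦ₂, coeff_X_pow_mul', hG]
    split_ifs with h
    · rw [coeff_mk, Nat.add_sub_cancel' h]
    · rfl
  have hcΦ₁ : ∀ n, coeff n Φ₁ = if n₁ ≤ n then 0 else coeff n Φ := by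
    intro n
    rw [hΦ₁, map_sub, hcΦ₂]
    split_ifs <;> ring
  have hΦ₂le : ∀ n, ‖coeff n Φ₂‖ ≤ M := fun n ↦ by
    rw [hcΦ₂]
    split_ifs
    · exact hΦ1 n
    · rw [norm_zero]; exact hMpos.le
  have hΦ₁le : ∀ n, ‖coeff n Φ₁‖ ≤ M' := fun n ↦ by
    rw [hcΦ₁]
    split_ifs with h
    · rw [norm_zero]; exact hM'0
    · exact hlowM' n (not_le.mp h)
  -- `Φ^i - Φ₂^i = Φ₁ · Σ Φ^l Φ₂^{i-1-l}` has coefficients `≤ M' M^{i-1}`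
  have hdiff : ∀ i n, 1 ≤ i → ‖coeff n (Φ ^ i - Φ₂ ^ i)‖ ≤ M' * M ^ (i - 1) := by
    intro i n hi
    have hgeom : Φ ^ i - Φ₂ ^ i = Φ₁ * ∑ l ∈ Finset.range i, Φ ^ l * Φ₂ ^ (i - 1 - l) := by
      rw [hΦ₁, mul_comm]
      exact (geom_sum₂_mul Φ Φ₂ i).symm
    rw [hgeom]
    refine norm_coeff_mul_le_of_forall_le hΦ₁le (fun m ↦ ?_) n
    refine norm_coeff_sum_le_of_forall_le (pow_nonneg hMpos.le _) (fun l hl m' ↦ ?_) m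
    have hl' : l < i := Finset.mem_range.mp hl
    calc ‖coeff m' (Φ ^ l * Φ₂ ^ (i - 1 - l))‖ ≤ M ^ l * M ^ (i - 1 - l) :=
          norm_coeff_mul_le_of_forall_le (norm_coeff_pow_le_of_forall_le hΦ1 l)
            (norm_coeff_pow_le_of_forall_le hΦ₂le _) m'
      _ = M ^ (i - 1) := by rw [← pow_add]; congr 1; omega
  have hM'M : ∀ i, 1 ≤ i → M' * M ^ (i - 1) < M ^ i := by
    intro i hi
    calc M' * M ^ (i - 1) < M * M ^ (i - 1) := mul_lt_mul_of_pos_right hM'lt (pow_pos hMpos _)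
      _ = M ^ i := by rw [← pow_succ', Nat.sub_add_cancel hi]
  -- low coefficients of `Φ^i`, and the leading one
  have hpow_low : ∀ i n, 1 ≤ i → n < i * n₁ → ‖coeff n (Φ ^ i)‖ ≤ M' * M ^ (i - 1) := by
    intro i n hi hn
    have h2 : coeff n (Φ₂ ^ i) = 0 := by
      rw [hΦ₂, mul_pow, ← pow_mul, coeff_X_pow_mul', if_neg (by rw [mul_comm]; omega)]
    have h := hdiff i n hi
    rwa [map_sub, h2, sub_zero] at h
  have hpow_lead : ∀ i, 1 ≤ i → ‖coeff (i * n₁) (Φ ^ i)‖ = M ^ i := by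
    intro i hi
    have h2 : coeff (i * n₁) (Φ₂ ^ i) = coeff n₁ Φ ^ i := by
      rw [hΦ₂, mul_pow, ← pow_mul, coeff_X_pow_mul', if_pos (by rw [mul_comm]), mul_comm i n₁,
        Nat.sub_self, coeff_zero_eq_constantCoeff_apply, map_pow, ← coeff_zero_eq_constantCoeff_apply,
        hG, coeff_mk, add_zero]
    have h := hdiff i (i * n₁) hi
    rw [map_sub, h2] at h
    rw [hM, ← norm_pow]
    exact norm_eq_of_norm_sub_lt' (h.trans_lt (by rw [norm_pow, ← hM]; exact hM'M i hi))
  -- the weights `w i = ‖b_i‖ M^i` and their smallest maximiser `js ∈ [1, J]`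
  set w : ℕ → ℝ := fun i ↦ ‖coeff i B‖ * M ^ i with hw
  have hwJ : w J = M ^ J := by simp only [hw, hBJ, one_mul]
  have hwpos : 0 < w J := by rw [hwJ]; exact pow_pos hMpos _
  obtain ⟨jm, hjm, hjmax⟩ := Finset.exists_max_image (Finset.Icc 1 J) w
    ⟨J, Finset.mem_Icc.mpr ⟨hJ, le_rfl⟩⟩
  have hex : ∃ i, i ∈ Finset.Icc 1 J ∧ ∀ l ∈ Finset.Icc 1 J, w l ≤ w i := ⟨jm, hjm, hjmax⟩
  set js : ℕ := Nat.find hex with hjs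
  obtain ⟨hjsI, hjsmax⟩ := Nat.find_spec hex
  obtain ⟨hjs1, hjsJ⟩ := Finset.mem_Icc.mp hjsI
  have hwle : ∀ l, 1 ≤ l → w l ≤ w js := by
    intro l hl
    by_cases hlJ : l ≤ J
    · exact hjsmax l (Finset.mem_Icc.mpr ⟨hl, hlJ⟩)
    · calc w l ≤ 1 * M ^ l := mul_le_mul_of_nonneg_right (hB l) (pow_nonneg hMpos.le _)
        _ ≤ M ^ J := by
          rw [one_mul]; exact pow_le_pow_of_le_one hMpos.le hM1 (by omega)
        _ = w J := hwJ.symm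
        _ ≤ w js := hjsmax J (Finset.mem_Icc.mpr ⟨hJ, le_rfl⟩)
  have hwjspos : 0 < w js := hwpos.trans_le (hwle J hJ)
  have hwlt : ∀ l, 1 ≤ l → l < js → w l < w js := by
    intro l hl hljs
    have hlS : ¬ (l ∈ Finset.Icc 1 J ∧ ∀ l' ∈ Finset.Icc 1 J, w l' ≤ w l) :=
      Nat.find_min hex (by rw [← hjs]; exact hljs)
    have hlI : l ∈ Finset.Icc 1 J := Finset.mem_Icc.mpr ⟨hl, by omega⟩
    rw [not_and] at hlS
    obtain ⟨l', hl'⟩ := not_forall.mp (hlS hlI)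
    obtain ⟨hl'I, hlt⟩ := Classical.not_imp.mp hl'
    exact (not_le.mp hlt).trans_le (hjsmax l' hl'I)
  -- the coefficient of `X^N`, `N = js · n₁`, on both sides
  set N : ℕ := js * n₁ with hN
  have hN1 : 1 ≤ N := Nat.one_le_iff_ne_zero.mpr (Nat.mul_ne_zero (by omega) (by omega))
  have hjsN : js < N + 1 := by
    have : js ≤ N := Nat.le_mul_of_pos_right js hn₁
    omega
  have hΦs : HasSubst Φ := HasSubst.of_constantCoeff_zero' hΦ0
  obtain ⟨Ψ, hΨ⟩ := X_dvd_iff.mpr hΦ0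
  have hcoefN : coeff N (B.subst Φ) = ∑ i ∈ Finset.range (N + 1), coeff i B * coeff N (Φ ^ i) := by
    rw [coeff_subst' hΦs, finsum_eq_sum_of_support_subset _ (s := Finset.range (N + 1)) ?_]
    · simp only [smul_eq_mul]
    · intro d hd
      rw [Function.mem_support] at hd
      rw [Finset.coe_range, Set.mem_Iio]
      by_contra hdN
      apply hd
      rw [not_lt] at hdN
      rw [hΨ, mul_pow, coeff_X_pow_mul', if_neg (by omega), smul_zero]
  -- the `js` term dominates
  have hmain : ‖coeff js B * coeff N (Φ ^ js)‖ = w js := by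
    rw [norm_mul, hN, hpow_lead js hjs1]
  have hrest : ∀ i ∈ (Finset.range (N + 1)).erase js, ‖coeff i B * coeff N (Φ ^ i)‖ < w js := by
    intro i hi
    obtain ⟨hijs, hiN⟩ := Finset.mem_erase.mp hi
    rcases Nat.eq_zero_or_pos i with h0 | hipos
    · rw [h0, coeff_zero_eq_constantCoeff_apply, hB0, zero_mul, norm_zero]; exact hwjspos
    rcases lt_or_gt_of_ne hijs with hlt | hgt
    · calc ‖coeff i B * coeff N (Φ ^ i)‖ ≤ ‖coeff i B‖ * M ^ i := by
            rw [norm_mul]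
            exact mul_le_mul_of_nonneg_left (norm_coeff_pow_le_of_forall_le hΦ1 i N) (norm_nonneg _)
        _ < w js := hwlt i hipos hlt
    · have hNi : N < i * n₁ := by
        rw [hN]; exact Nat.mul_lt_mul_of_pos_right hgt hn₁
      by_cases hbi : coeff i B = 0
      · rw [hbi, zero_mul, norm_zero]; exact hwjspos
      · calc ‖coeff i B * coeff N (Φ ^ i)‖ ≤ ‖coeff i B‖ * (M' * M ^ (i - 1)) := by
              rw [norm_mul]
              exact mul_le_mul_of_nonneg_left (hpow_low i N hipos hNi) (norm_nonneg _)
          _ < ‖coeff i B‖ * M ^ i := mul_lt_mul_of_pos_left (hM'M i hipos) (norm_pos_iff.mpr hbi)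
          _ ≤ w js := hwle i hipos
  have hrest' : ‖∑ i ∈ (Finset.range (N + 1)).erase js, coeff i B * coeff N (Φ ^ i)‖ < w js := by
    rcases ((Finset.range (N + 1)).erase js).eq_empty_or_nonempty with he | hne'
    · rw [he, Finset.sum_empty, norm_zero]; exact hwjspos
    · obtain ⟨i₀, hi₀, hmax₀⟩ := Finset.exists_max_image _ (fun i ↦ ‖coeff i B * coeff N (Φ ^ i)‖) hne'
      exact (IsUltrametricDist.norm_sum_le_of_forall_le_of_nonempty hne' hmax₀).trans_lt (hrest i₀ hi₀)
  have hLHS : ‖coeff N (B.subst Φ)‖ = w js := by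
    rw [hcoefN, ← Finset.add_sum_erase _ _ (Finset.mem_range.mpr hjsN), ← hmain]
    rw [← hmain] at hrest'
    rw [IsUltrametricDist.norm_add_eq_max_of_norm_ne_norm (ne_of_gt hrest'), max_eq_left hrest'.le]
  have hRHS : ‖coeff N (rescale c Φ)‖ ≤ ‖c‖ * M := by
    rw [coeff_rescale, norm_mul, norm_pow]
    exact mul_le_mul (pow_le_pow_of_le_one (norm_nonneg _) hc hN1 |>.trans (pow_one _).le)
      (hΦ1 N) (norm_nonneg _) (norm_nonneg _)
  have hkey : w js ≤ ‖c‖ * M := by rw [← hLHS, heq]; exact hRHS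
  exact (hwle j hj).trans hkey

end Ultrametric

section Discrete

open scoped IntermediateField
open Literature.NumberTheory.GaloisRepresentations IsLocalRing

variable {p : ℕ} [Fact p.Prime]

/-- **Norms on `𝒪_K` are powers of the norm of a uniformiser** (`K/ℚ_p` finite, `𝒪_K` a
discrete valuation ring). [folklore] -/
theorem exists_norm_coe_eq_pow (K : IntermediateField ℚ_[p] (PadicAlgCl p))
    [FiniteDimensional ℚ_[p] K] :
    ∃ ρ : ℝ, 0 < ρ ∧ ρ < 1 ∧ ∀ x : padicCoeffRing K, x ≠ 0 →
      ∃ n : ℕ, ‖((x : K) : PadicAlgCl p)‖ = ρ ^ n := by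
  letI := isLocalRing_padicCoeffRing K
  haveI := isDiscreteValuationRing_padicCoeffRing K
  obtain ⟨ϖ, hϖ⟩ := IsDiscreteValuationRing.exists_irreducible (padicCoeffRing K)
  refine ⟨‖((ϖ : K) : PadicAlgCl p)‖, ?_, ?_, fun x hx ↦ ?_⟩
  · rw [norm_pos_iff]
    intro h0
    apply hϖ.ne_zero
    have h1 : (ϖ : K) = 0 := by exact_mod_cast h0
    exact_mod_cast h1
  · exact (mem_nonunits_padicCoeffRing_iff K ϖ).mp (mem_nonunits_iff.mpr hϖ.not_isUnit)
  · obtain ⟨n, v, hxv⟩ := IsDiscreteValuationRing.eq_unit_mul_pow_irreducible hx hϖ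
    refine ⟨n, ?_⟩
    have hv : ‖(((v : padicCoeffRing K) : K) : PadicAlgCl p)‖ = 1 :=
      (isUnit_padicCoeffRing_iff K _).mp v.isUnit
    rw [hxv]
    push_cast
    rw [norm_mul, norm_pow, hv, one_mul]

/-- **Over `𝒪_K` the coefficient norms of a nonzero series attain their maximum**, first at some
index `n₁`. [folklore] -/
theorem exists_index_norm_coeff_max (K : IntermediateField ℚ_[p] (PadicAlgCl p))
    [FiniteDimensional ℚ_[p] K] {Φ : (padicCoeffRing K)⟦X⟧} {n₀ : ℕ} (hn₀ : coeff n₀ Φ ≠ 0) :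
    ∃ n₁ : ℕ, coeff n₁ Φ ≠ 0 ∧
      (∀ n, ‖(((coeff n Φ : padicCoeffRing K) : K) : PadicAlgCl p)‖ ≤ ‖(((coeff n₁ Φ : padicCoeffRing K) : K) : PadicAlgCl p)‖) ∧
      ∀ n < n₁, ‖(((coeff n Φ : padicCoeffRing K) : K) : PadicAlgCl p)‖ < ‖(((coeff n₁ Φ : padicCoeffRing K) : K) : PadicAlgCl p)‖ := by
  classical
  obtain ⟨ρ, hρ0, hρ1, hρ⟩ := exists_norm_coe_eq_pow K
  have hP : ∃ v : ℕ, ∃ n, ρ ^ v ≤ ‖(((coeff n Φ : padicCoeffRing K) : K) : PadicAlgCl p)‖ := by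
    obtain ⟨v₀, hv₀⟩ := hρ _ hn₀
    exact ⟨v₀, n₀, hv₀.ge⟩
  set m : ℕ := Nat.find hP with hm
  have hle : ∀ n, ‖(((coeff n Φ : padicCoeffRing K) : K) : PadicAlgCl p)‖ ≤ ρ ^ m := by
    intro n
    by_cases h0 : coeff n Φ = 0
    · rw [h0]; push_cast; rw [norm_zero]; exact pow_nonneg hρ0.le _
    obtain ⟨j, hj⟩ := hρ _ h0
    rw [hj]
    by_contra hcon
    rw [not_le, pow_lt_pow_iff_right_of_lt_one₀ hρ0 hρ1] at hcon
    exact Nat.find_min hP (by rw [← hm]; exact hcon) ⟨n, hj.symm.le⟩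
  have hQ : ∃ n, ρ ^ m ≤ ‖(((coeff n Φ : padicCoeffRing K) : K) : PadicAlgCl p)‖ := Nat.find_spec hP
  refine ⟨Nat.find hQ, ?_, fun n ↦ ?_, fun n hn ↦ ?_⟩
  · intro h0
    have h := Nat.find_spec hQ
    rw [h0] at h
    push_cast at h
    rw [norm_zero] at h
    exact absurd h (not_le.mpr (pow_pos hρ0 _))
  · exact (hle n).trans (Nat.find_spec hQ)
  · exact (not_le.mp (Nat.find_min hQ hn)).trans_le (Nat.find_spec hQ)

/-- **If `rᵛ · (rᵏ · ‖u‖)^{j-1} ≤ p⁻¹` with `rᵉ = p⁻¹`, `(j - 1)k + v < je` and `u ∈ ℚ_p`,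
then `‖u‖ ≤ 1`**: the norm of a nonzero `p`-adic number is an integral power of `p`. (The
Newton-polygon bound at the vertex `(j, v)`.) [folklore] -/
theorem _root_.Padic.norm_le_one_of_pow_mul_pow_mul_norm_pow_le {u : ℚ_[p]} {r : ℝ}
    {e k j v : ℕ} (hr0 : 0 ≤ r) (hr : r ^ e = (p : ℝ)⁻¹) (hj : 1 ≤ j)
    (hke : (j - 1) * k + v < j * e) (h : r ^ v * (r ^ k * ‖u‖) ^ (j - 1) ≤ (p : ℝ)⁻¹) :
    ‖u‖ ≤ 1 := by
  have hp1 : (1 : ℝ) < p := by exact_mod_cast (Fact.out : p.Prime).one_lt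
  have hp0 : (0 : ℝ) < p := by positivity
  by_contra hu
  rw [not_le] at hu
  have hu0 : u ≠ 0 := fun h0 ↦ by rw [h0, norm_zero] at hu; exact absurd hu (by norm_num)
  -- `‖u‖ = p^m` with `m ≥ 1`
  have hnorm := Padic.norm_eq_zpow_neg_valuation hu0
  have hm : 1 ≤ -u.valuation := by
    by_contra hm
    rw [not_le] at hm
    have : ‖u‖ ≤ 1 := by
      rw [hnorm]
      exact zpow_le_one_of_nonpos₀ hp1.le (by omega)
    exact absurd hu (not_lt.mpr this)
  have hpu : (p : ℝ) ≤ ‖u‖ := by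
    rw [hnorm]
    calc (p : ℝ) = (p : ℝ) ^ (1 : ℤ) := (zpow_one _).symm
      _ ≤ (p : ℝ) ^ (-u.valuation) := zpow_le_zpow_right₀ hp1.le hm
  -- `p^{-e} ≥ (rᵛ(rᵏ‖u‖)^{j-1})ᵉ = p^{-(v + k(j-1))} ‖u‖^{(j-1)e} ≥ p^{-(v+k(j-1))} p^{(j-1)e}`
  have h1 : (r ^ v * (r ^ k * ‖u‖) ^ (j - 1)) ^ e ≤ ((p : ℝ)⁻¹) ^ e :=
    pow_le_pow_left₀ (by positivity) h e
  have h2 : (r ^ v * (r ^ k * ‖u‖) ^ (j - 1)) ^ e =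
      ((p : ℝ)⁻¹) ^ (v + k * (j - 1)) * ‖u‖ ^ ((j - 1) * e) := by
    rw [← hr]; ring
  rw [h2] at h1
  have h3 : ((p : ℝ)⁻¹) ^ (v + k * (j - 1)) * (p : ℝ) ^ ((j - 1) * e) ≤
      ((p : ℝ)⁻¹) ^ (v + k * (j - 1)) * ‖u‖ ^ ((j - 1) * e) := by
    gcongr
  have h4 := h3.trans h1
  rw [inv_pow, inv_pow, inv_mul_le_iff₀ (by positivity), ← div_eq_mul_inv,
    le_div_iff₀ (by positivity), ← pow_add, pow_le_pow_iff_right₀ hp1] at h4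
  have h5 : j * e = (j - 1) * e + e := by
    conv_lhs => rw [← Nat.sub_add_cancel hj]
    ring
  rw [h5] at hke
  linarith

/-- **If `(rᵏ · ‖u‖)^{J-1} ≤ p⁻¹` with `rᵉ = p⁻¹`, `(J - 1)k < Je` and `u ∈ ℚ_p`, then
`‖u‖ ≤ 1`** (`v = 0`; `J - 1 = 1`, `k < e`: `Padic.norm_le_one_of_pow_mul_norm_le_one`).
[folklore] -/
theorem _root_.Padic.norm_le_one_of_pow_mul_norm_pow_le {u : ℚ_[p]} {r : ℝ} {e k J : ℕ}
    (hr0 : 0 ≤ r) (hr : r ^ e = (p : ℝ)⁻¹) (hJ : 1 ≤ J) (hke : (J - 1) * k < J * e)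
    (h : (r ^ k * ‖u‖) ^ (J - 1) ≤ (p : ℝ)⁻¹) : ‖u‖ ≤ 1 :=
  Padic.norm_le_one_of_pow_mul_pow_mul_norm_pow_le (v := 0) hr0 hr hJ (by rwa [add_zero])
    (by rwa [pow_zero, one_mul])

end Discrete

section SubstHelpers

variable {R : Type*} [CommRing R]

/-- `(C r · f)(a) = C r · f(a)`. [folklore] -/
theorem subst_C_mul' {a : R⟦X⟧} (ha : HasSubst a) (r : R) (f : R⟦X⟧) :
    (C r * f).subst a = C r * f.subst a := by
  rw [← smul_eq_C_mul, ← smul_eq_C_mul, subst_smul ha]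

end SubstHelpers

open scoped Classical IntermediateField

open Literature.RingTheory.FormalGroups Literature.NumberTheory.EllipticCurves.ModularForms
open Literature.NumberTheory.EllipticCurves.HondaCongruence Literature.NumberTheory.Automorphic
open Literature.NumberTheory.GaloisRepresentations
open _root_.WeierstrassCurve
open scoped MatrixGroups ModularForm
open CongruenceSubgroup IsLocalRing

set_option maxHeartbeats 400000 in
/-- **The global half of the capstone, in isolation.** From the data of
`edixhoven_int_of_neronLattice_eq_smul_periodLattice` (`W'/ℚ` globally minimal, `IsNewformOf W' f`,
`Λ_{L'} = q Λ_f` exactly): a rational `u > 0` with `u = ±q`, and a parameter `t₀ ∈ Xℚ⟦X⟧` of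
`W'` with `[X¹]t₀ = u`, `log_{W'}(t₀) = u · Σ aₙ(W')Xⁿ/n`, such that `t₀` and `w_{W'}(t₀)` lie
in `Frac ℤ⟦X⟧` (the modular parametrisation read through the `x,y`-dictionary and the change of
variables `C • E = W'`, `u = u(C)`; Steps 1–4 of `ManinConstantSemistableTwistProofs`).
[cite: EdixhovenManin1991, Prop. 2] [cite: PastenShimura2024, §10.1 (p. 33)] -/
theorem exists_formalParam_of_neronLattice_eq_smul_periodLattice {N : ℕ} [NeZero N]
    {W' : WeierstrassCurve ℚ} [W'.IsElliptic] [W'.IsGloballyMinimal] {f : CuspForm (Gamma0 N) 2}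
    {L' : PeriodPair} (hf : IsNewformOf W' f) (hL' : IsNeronLatticeOf (W'.baseChange ℂ) L')
    {q : ℚ} (hq : ∀ z ∈ periodLattice f, (q : ℂ) * z ∈ L'.lattice)
    (hq' : ∀ z ∈ L'.lattice, ∃ w ∈ periodLattice f, z = q * w) :
    ∃ u : ℚ, 0 < u ∧ (u = q ∨ u = -q) ∧ ∃ t₀ : ℚ⟦X⟧, constantCoeff t₀ = 0 ∧ coeff 1 t₀ = u ∧
      W'.formalLog.subst t₀ = C u * (PowerSeries.mk fun n ↦ ((W'.LFunction n : ℤ) : ℚ) / n) ∧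
      ∃ P' Q' P₂' Q₂' : ℤ⟦X⟧, Q' ≠ 0 ∧ t₀ * Q'.map (Int.castRingHom ℚ) = P'.map (Int.castRingHom ℚ) ∧
        Q₂' ≠ 0 ∧
        W'.formalW.subst t₀ * Q₂'.map (Int.castRingHom ℚ) = P₂'.map (Int.castRingHom ℚ) := by
  /- Step 1: lattices. `q ≠ 0`, `L := q⁻¹ L'` spans `Λ_f`, the short model `E` of `ℂ/Λ_f`. -/
  have hq0 : q ≠ 0 := by
    rintro rfl
    obtain ⟨w, -, hw⟩ := hq' L'.ω₁ L'.ω₁_mem_lattice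
    rw [Rat.cast_zero, zero_mul] at hw
    exact (LinearIndependent.ne_zero 0 L'.indep) (by simpa using hw)
  have hqC : (q : ℂ) ≠ 0 := by exact_mod_cast hq0
  set L : PeriodPair := L'.mulLeft ((q : ℂ)⁻¹) (inv_ne_zero hqC) with hLdef
  have hL : ∀ x, x ∈ L.lattice ↔ x ∈ periodLattice f := fun x ↦ by
    rw [hLdef, PeriodPair.mem_mulLeft_lattice, inv_inv]
    constructor
    · intro hx
      obtain ⟨w, hw, hxw⟩ := hq' _ hx
      rwa [mul_left_cancel₀ hqC hxw]
    · exact hq x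
  have hΛ : L'.lattice = (L.mulLeft (q : ℂ) hqC).lattice := by
    ext z
    rw [PeriodPair.mem_mulLeft_lattice, hL]
    constructor
    · intro hz
      obtain ⟨w, hw, rfl⟩ := hq' z hz
      rwa [← mul_assoc, inv_mul_cancel₀ hqC, one_mul]
    · intro hz
      have h := hq _ hz
      rwa [← mul_assoc, mul_inv_cancel₀ hqC, one_mul] at h
  have hf0 : f ≠ 0 := hf.1.ne_zero
  have ha : ∀ n, ((W'.LFunction n : ℤ) : ℂ) = cuspCoeff f n := fun n ↦ (hf.2 n).symm
  have hrat : ∀ n, ∃ r : ℚ, (r : ℂ) = cuspCoeff f n := fun n ↦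
    ⟨(W'.LFunction n : ℚ), by rw [← ha n, Rat.cast_intCast]⟩
  obtain ⟨⟨q₂, hq₂⟩, ⟨q₃, hq₃⟩⟩ :=
    PeriodPair.ratCast_g₂_g₃_of_lattice_eq_periodLattice f hf0 hrat L hL
  set a₄ : ℚ := -q₂ / 4 with ha₄
  set a₆ : ℚ := -q₃ / 4 with ha₆
  have h₂ : L.g₂ = -4 * (a₄ : ℂ) := by rw [← hq₂, ha₄]; push_cast; ring
  have h₃ : L.g₃ = -4 * (a₆ : ℂ) := by rw [← hq₃, ha₆]; push_cast; ring
  set E : WeierstrassCurve ℚ := { a₁ := 0, a₂ := 0, a₃ := 0, a₄ := a₄, a₆ := a₆ } with hE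
  haveI hEe : E.IsElliptic := isElliptic_shortModel h₂ h₃
  have hEL : IsNeronLatticeOf (E.baseChange ℂ) L := isNeronLatticeOf_shortModel h₂ h₃
  /- Step 2: the modular parametrisation as a formal series `z ∈ Xℚ⟦X⟧ ∩ Frac ℤ⟦X⟧`, with
  `w_E(z) ∈ Frac ℤ⟦X⟧` as well (the `x,y`-dictionary). -/
  obtain ⟨z, P, Q, P₂, Q₂, hz0, hQ, hPQ, hQ₂, hPQ₂, hlog⟩ := exists_rat_series_formalLog_subst_eq_formalW f hf0
    (W'.LFunction : ℕ → ℤ) ha L (fun x hx ↦ (hL x).mpr hx) a₄ a₆ h₂ h₃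
  /- Step 3: `C • E = W'` over `ℚ` with `0 < u(C)` and `‖u(C)‖_p = ‖q‖_p`. -/
  obtain ⟨e₄, e₆⟩ := hL'.c₄_eq_of_lattice_eq_mulLeft hqC hΛ
  have hc₄E : (E.baseChange ℂ).c₄ = (E.c₄ : ℂ) := by
    simp [WeierstrassCurve.baseChange, WeierstrassCurve.map_c₄]
  have hc₆E : (E.baseChange ℂ).c₆ = (E.c₆ : ℂ) := by
    simp [WeierstrassCurve.baseChange, WeierstrassCurve.map_c₆]
  have h₄ : W'.c₄ = (q ^ 4)⁻¹ * E.c₄ := by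
    have h : ((W'.c₄ : ℚ) : ℂ) = (((q ^ 4)⁻¹ * E.c₄ : ℚ) : ℂ) := by
      rw [e₄, hEL.1, hc₄E]; push_cast; ring
    exact_mod_cast h
  have h₆ : W'.c₆ = (q ^ 6)⁻¹ * E.c₆ := by
    have h : ((W'.c₆ : ℚ) : ℂ) = (((q ^ 6)⁻¹ * E.c₆ : ℚ) : ℂ) := by
      rw [e₆, hEL.2, hc₆E]; push_cast; ring
    exact_mod_cast h
  obtain ⟨vc, hC, hCpos⟩ : ∃ vc : VariableChange ℚ, vc • E = W' ∧ 0 < (vc.u : ℚ) := by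
    obtain ⟨vc, hC⟩ := exists_variableChange_of_c₄_eq_of_c₆_eq hq0 h₄ h₆
    rcases lt_or_gt_of_ne vc.u.ne_zero with hneg | hpos
    · have hE' : (⟨-1, 0, 0, 0⟩ : VariableChange ℚ) • E = E := by
        rw [hE, smul_shortModel, inv_neg_one]
        congr 1 <;> push_cast <;> ring
      refine ⟨vc * ⟨-1, 0, 0, 0⟩, by rw [mul_smul, hE', hC], ?_⟩
      show 0 < ((vc.u * -1 : ℚˣ) : ℚ)
      rw [Units.val_mul, Units.val_neg, Units.val_one]
      linarith
    · exact ⟨vc, hC, hpos⟩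
  have hCu0 : (vc.u : ℚ) ≠ 0 := vc.u.ne_zero
  -- `u(vc) = ±q`
  have hsign : (vc.u : ℚ) = q ∨ (vc.u : ℚ) = -q := by
    have hW4 : W'.c₄ = ((vc.u : ℚ))⁻¹ ^ 4 * E.c₄ := by
      rw [← hC, variableChange_c₄, Units.val_inv_eq_inv_val]
    have hW6 : W'.c₆ = ((vc.u : ℚ))⁻¹ ^ 6 * E.c₆ := by
      rw [← hC, variableChange_c₆, Units.val_inv_eq_inv_val]
    have hΔ : E.c₄ ≠ 0 ∨ E.c₆ ≠ 0 := by
      by_contra hcon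
      rw [not_or, not_not, not_not] at hcon
      have h1728 := E.c_relation
      rw [hcon.1, hcon.2] at h1728
      exact E.isUnit_Δ.ne_zero (by linear_combination (1 / 1728 : ℚ) * h1728)
    have key : (vc.u : ℚ) ^ 4 = q ^ 4 ∨ (vc.u : ℚ) ^ 6 = q ^ 6 := by
      rcases hΔ with hc | hc
      · left
        have h' := mul_right_cancel₀ hc (hW4.symm.trans h₄)
        rw [inv_pow] at h'
        exact inv_injective h'
      · right
        have h' := mul_right_cancel₀ hc (hW6.symm.trans h₆)
        rw [inv_pow] at h'
        exact inv_injective h'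
    rcases key with h | h
    · rcases pow_eq_pow_iff_cases.mp h with h0 | h1 | ⟨h2, -⟩
      · omega
      · exact Or.inl h1
      · exact Or.inr h2
    · rcases pow_eq_pow_iff_cases.mp h with h0 | h1 | ⟨h2, -⟩
      · omega
      · exact Or.inl h1
      · exact Or.inr h2
  /- Step 4: the parameter `t₀ = θ_C(z)` of `W'` over `ℚ`: `[X¹]t₀ = u`, `log_{W'}(t₀) = u·ℓ`,
  and `t₀, w_{W'}(t₀) ∈ Frac ℤ⟦X⟧` by the dictionary. -/
  have hz1 : coeff 1 z = 1 := by
    have h1 := congrArg (coeff 1) hlog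
    rwa [coeff_one_subst_eq_mul _ hz0, coeff_one_formalLog, one_mul, coeff_mk, Nat.cast_one,
      div_one, W'.isMultiplicative_LFunction.map_one, Int.cast_one] at h1
  set t₀ : ℚ⟦X⟧ := (E.formalVariableChange vc).subst z with ht₀
  have ht₀0 : constantCoeff t₀ = 0 :=
    (constantCoeff_subst_eq_constantCoeff hz0).trans (E.constantCoeff_formalVariableChange vc)
  have ht₀1 : coeff 1 t₀ = (vc.u : ℚ) := by
    rw [ht₀, E.coeff_one_formalVariableChange_subst vc hz0, hz1, mul_one]
  have hlog₀ : W'.formalLog.subst t₀ = C (vc.u : ℚ) * PowerSeries.mk fun n ↦ ((W'.LFunction n : ℤ) : ℚ) / n := by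
    rw [ht₀, ← hlog, ← hC]
    exact E.formalLog_subst_formalVariableChange_subst vc hz0
  obtain ⟨P', Q', hQ', hPQ'⟩ := E.exists_int_frac_formalVariableChange_subst vc hz0 hQ hPQ hQ₂ hPQ₂
  obtain ⟨P₂', Q₂', hQ₂', hPQ₂'⟩ := E.exists_int_frac_formalW_smul_subst vc hz0 hQ hPQ hQ₂ hPQ₂
  rw [← ht₀] at hPQ'
  rw [hC, ← ht₀] at hPQ₂'
  exact ⟨(vc.u : ℚ), hCpos, hsign, t₀, ht₀0, ht₀1, hlog₀, P', Q', P₂', Q₂', hQ', hPQ', hQ₂', hPQ₂'⟩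

set_option maxHeartbeats 4000000 in
/-- **Steps 5–9 of the capstone, in isolation: the integral parameter `t₃`.** In the setting
of `padicNorm_le_one_of_formalLog_subst_eq_of_semistableTwist` (no hypothesis on `k`): there is
`t₃ ∈ XO⟦X⟧`, `O = 𝒪_K`, with `[X¹]t₃ = πᵏu` and
`log_{V''}(t₃) = πᵏu · Σ aₙ(W')Xⁿ/n` over `K` — namely `t₃ = θ(t₀)`, integral by the local
lemma `Literature.RingTheory.PowerSeries.exists_map_eq_of_subst_eq_map`.
[cite: Honda1970, Thm. 2 (p. 223)] [cite: EdixhovenManin1991, Prop. 2] -/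
theorem exists_integral_param_of_semistableTwist
    (W' : WeierstrassCurve ℚ) [W'.IsElliptic] [W'.IsGloballyMinimal] {p : ℕ} [Fact p.Prime]
    {u : ℚ} (hCpos : 0 < u) {t₀ : ℚ⟦X⟧} (ht₀0 : constantCoeff t₀ = 0) (ht₀1 : coeff 1 t₀ = u)
    (hlog₀ : W'.formalLog.subst t₀ = C u * PowerSeries.mk fun n ↦ ((W'.LFunction n : ℤ) : ℚ) / n)
    {P' Q' P₂' Q₂' : ℤ⟦X⟧} (hQ' : Q' ≠ 0)
    (hPQ' : t₀ * Q'.map (Int.castRingHom ℚ) = P'.map (Int.castRingHom ℚ)) (hQ₂' : Q₂' ≠ 0)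
    (hPQ₂' : W'.formalW.subst t₀ * Q₂'.map (Int.castRingHom ℚ) = P₂'.map (Int.castRingHom ℚ))
    (hψex : ∃ ψ : ℚ_[p]⟦X⟧, constantCoeff ψ = 0 ∧ (∀ n, ‖coeff n ψ‖ ≤ 1) ∧
      (W'.map (algebraMap ℚ ℚ_[p])).formalLog.subst ψ =
        PowerSeries.mk fun k ↦ ((W'.LFunction k : ℤ) : ℚ_[p]) / k)
    (K : IntermediateField ℚ_[p] (PadicAlgCl p)) [FiniteDimensional ℚ_[p] K]
    (πu : Kˣ) {e k : ℕ} (hπe : ‖((πu : K) : PadicAlgCl p)‖ ^ e = (p : ℝ)⁻¹)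
    (r s t : padicCoeffRing K) (V'' : WeierstrassCurve (padicCoeffRing K))
    (hV'' : V''.map (algebraMap (padicCoeffRing K) K) =
      (⟨πu ^ k, (r : K), (s : K), (t : K)⟩ : VariableChange K) • W'.map (algebraMap ℚ K))
    (hfin : ∃ J : ℕ, 0 < J ∧ IsUnit (coeff J (V''.formalMul p))) :
    ∃ t₃ : (padicCoeffRing K)⟦X⟧, constantCoeff t₃ = 0 ∧
      algebraMap (padicCoeffRing K) K (coeff 1 t₃) = (πu : K) ^ k * algebraMap ℚ K u ∧
      (V''.map (algebraMap (padicCoeffRing K) K)).formalLog.subst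
          (t₃.map (algebraMap (padicCoeffRing K) K)) =
        C ((πu : K) ^ k * algebraMap ℚ K u) *
          PowerSeries.mk fun n ↦ ((W'.LFunction n : ℤ) : K) / n := by
  obtain ⟨J, hJ, hJu⟩ := hfin
  have ht₀s : HasSubst t₀ := HasSubst.of_constantCoeff_zero' ht₀0
  /- Step 5: the ring `(padicCoeffRing K) = 𝒪_K` (a complete DVR), `π`, and the maps. -/
  letI hOloc : IsLocalRing (padicCoeffRing K) := isLocalRing_padicCoeffRing K
  haveI hOpid : IsPrincipalIdealRing (padicCoeffRing K) := isPrincipalIdealRing_padicCoeffRing K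
  haveI hOcpl : IsAdicComplete (maximalIdeal (padicCoeffRing K)) (padicCoeffRing K) := isAdicComplete_padicCoeffRing K
  letI hOch : CharP (ResidueField (padicCoeffRing K)) p := charP_residueField_padicCoeffRing K
  have hp1R : (1 : ℝ) < p := by exact_mod_cast (Fact.out : p.Prime).one_lt
  set π : PadicAlgCl p := ((πu : K) : PadicAlgCl p) with hπdef
  have he0 : e ≠ 0 := by
    rintro rfl
    rw [pow_zero] at hπe
    exact absurd hπe.symm (ne_of_lt (inv_lt_one_of_one_lt₀ hp1R))
  have hπle : ‖π‖ ≤ 1 := by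
    by_contra hcon
    rw [not_le] at hcon
    have h1 : (1 : ℝ) < ‖π‖ ^ e := one_lt_pow₀ hcon he0
    rw [hπe] at h1
    exact absurd h1 (not_lt.mpr (inv_le_one_of_one_le₀ hp1R.le))
  have hπlt : ‖π‖ < 1 := by
    by_contra hcon
    rw [not_lt] at hcon
    have h1 : (1 : ℝ) ≤ ‖π‖ ^ e := one_le_pow₀ hcon
    rw [hπe] at h1
    exact absurd h1 (not_le.mpr (inv_lt_one_of_one_lt₀ hp1R))
  set πO : (padicCoeffRing K) := ⟨(πu : K), (mem_padicCoeffRing_iff K _).mpr hπle⟩ with hπOdef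
  have hπOc : ((πO : (padicCoeffRing K)) : K) = (πu : K) := rfl
  have hπOmax : πO ∈ maximalIdeal (padicCoeffRing K) := by
    rw [mem_maximalIdeal_padicCoeffRing_iff, hπOc]; exact hπlt
  set ι : ℤ_[p] →+* (padicCoeffRing K) := padicIntToCoeffRing K with hιdef
  set φK : ℚ_[p] →+* K := algebraMap ℚ_[p] K with hφK
  set φ : ℚ →+* ℚ_[p] := algebraMap ℚ ℚ_[p] with hφ
  set φQ : ℚ →+* K := algebraMap ℚ K with hφQ
  have halgO : ∀ y : (padicCoeffRing K), algebraMap (padicCoeffRing K) K y = (y : K) := fun y ↦ rfl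
  have hinjO : Function.Injective (algebraMap (padicCoeffRing K) K) := fun x y h ↦ Subtype.ext h
  have hιφ : ∀ x : ℤ_[p], algebraMap (padicCoeffRing K) K (ι x) = φK (x : ℚ_[p]) := fun x ↦ rfl
  have hcomp : φK.comp φ = φQ := RingHom.ext fun x ↦ by
    rw [eq_ratCast (φK.comp φ) x, eq_ratCast φQ x]
  have hmm : ∀ R : ℤ_[p]⟦X⟧, (R.map ι).map (algebraMap (padicCoeffRing K) K) =
      (R.map (algebraMap ℤ_[p] ℚ_[p])).map φK := fun R ↦ by
    ext n
    simp only [coeff_map, hιφ]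
    rfl
  have hintQ : ∀ R : ℤ⟦X⟧, ((R.map (Int.castRingHom ℤ_[p])).map ι).map (algebraMap (padicCoeffRing K) K) =
      (R.map (Int.castRingHom ℚ)).map φQ := fun R ↦ by
    ext n
    simp [coeff_map]
  /- Step 6: the curves over `K`: `WK = W' ⊗ K = VO ⊗ K`, the twist `W'' = C'' • WK = V'' ⊗ K`,
  the integral isomorphism `θ`, and the series `t''`, its logarithm, its `Frac (padicCoeffRing K)⟦X⟧`-witness. -/
  set WK : WeierstrassCurve K := W'.map φQ with hWK
  set VO : WeierstrassCurve (padicCoeffRing K) := (integralModelInt W').map (Int.castRingHom (padicCoeffRing K)) with hVO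
  have hVOK : VO.map (algebraMap (padicCoeffRing K) K) = WK := by
    have h1 : ((integralModelInt W').map (Int.castRingHom ℚ)).map φQ = W'.map φQ := by
      rw [map_integralModelInt]
    rw [map_map] at h1
    rw [hVO, map_map, hWK]
    exact (congrArg (integralModelInt W').map (RingHom.ext_int _ _)).trans h1
  set C'' : VariableChange K := ⟨πu ^ k, (r : K), (s : K), (t : K)⟩ with hC''
  set W'' : WeierstrassCurve K := C'' • WK with hW''
  have hV''K : V''.map (algebraMap (padicCoeffRing K) K) = W'' := by rw [hW'', hC'', hWK, hV'']
  obtain ⟨θ₀, hθ₀, hθ₀0, hθ₀1⟩ := VO.exists_map_eq_formalVariableChange C'' (πO ^ k) r s t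
    (by rw [hC'', Units.val_pow_eq_pow_val, map_pow, halgO, hπOc]) rfl rfl rfl
  rw [hVOK] at hθ₀
  set θ := WK.formalVariableChange C'' with hθ
  have hθ0 : constantCoeff θ = 0 := WK.constantCoeff_formalVariableChange C''
  have hθs : HasSubst θ := HasSubst.of_constantCoeff_zero' hθ0
  have hθ₀s : HasSubst θ₀ := HasSubst.of_constantCoeff_zero' hθ₀0
  -- `t₀` over `K` and `t'' = θ(t₀)`
  set t₀K : K⟦X⟧ := t₀.map φQ with ht₀K
  have ht₀K0 : constantCoeff t₀K = 0 := by
    rw [ht₀K, ← coeff_zero_eq_constantCoeff, coeff_map, coeff_zero_eq_constantCoeff, ht₀0, map_zero]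
  have ht₀Ks : HasSubst t₀K := HasSubst.of_constantCoeff_zero' ht₀K0
  have ht₀K1 : coeff 1 t₀K = φQ u := by rw [ht₀K, coeff_map, ht₀1]
  set ℓK : K⟦X⟧ := PowerSeries.mk fun k ↦ ((W'.LFunction k : ℤ) : K) / k with hℓK
  have hℓ' : (PowerSeries.mk fun n ↦ ((W'.LFunction n : ℤ) : ℚ) / n).map φQ = ℓK := by
    ext n; rw [coeff_map, coeff_mk, hℓK, coeff_mk, map_div₀, map_natCast, map_intCast]
  have hlogK : WK.formalLog.subst t₀K = C (φQ u) * ℓK := by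
    rw [ht₀K, hWK, ← W'.map_formalLog φQ, ← powerSeries_map_subst ht₀s φQ, hlog₀, map_mul, map_C, hℓ']
  set t'' : K⟦X⟧ := θ.subst t₀K with ht''
  have ht''0 : constantCoeff t'' = 0 := (constantCoeff_subst_eq_constantCoeff ht₀K0).trans hθ0
  have ht''s : HasSubst t'' := HasSubst.of_constantCoeff_zero' ht''0
  have ht''1 : coeff 1 t'' = (πu : K) ^ k * φQ u := by
    rw [ht'', hθ, WK.coeff_one_formalVariableChange_subst C'' ht₀K0, ht₀K1, hC'', Units.val_pow_eq_pow_val]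
  have hlog'' : W''.formalLog.subst t'' = C ((πu : K) ^ k) * (C (φQ u) * ℓK) := by
    rw [ht'', hW'', hθ, WK.formalLog_subst_formalVariableChange_subst C'' ht₀K0, hlogK, hC'',
      Units.val_pow_eq_pow_val]
  -- the `Frac (padicCoeffRing K)⟦X⟧`-witness for `t''`: `t''·(Q'Q₂' + sP'Q₂' + (t − sr)Q'P₂') = πᵏ(P'Q₂' − rQ'P₂')`
  have hwK : WK.formalW.subst t₀K = PowerSeries.map φQ (W'.formalW.subst t₀) := by
    rw [ht₀K, hWK, ← map_formalW, powerSeries_map_subst ht₀s φQ]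
  have keyK := WK.subst_formalVariableChange_mul_denom C'' ht₀K0
  rw [← hθ, ← ht'', hwK] at keyK
  set iO : ℤ⟦X⟧ → (padicCoeffRing K)⟦X⟧ := fun R ↦ (R.map (Int.castRingHom ℤ_[p])).map ι with hiO
  set Q'' : (padicCoeffRing K)⟦X⟧ := iO Q' * iO Q₂' + C s * iO P' * iO Q₂' + C (t - s * r) * iO Q' * iO P₂' with hQ''
  set P'' : (padicCoeffRing K)⟦X⟧ := C (πO ^ k) * (iO P' * iO Q₂' - C r * iO Q' * iO P₂') with hP''
  have hmapP' : (iO P').map (algebraMap (padicCoeffRing K) K) = (P'.map (Int.castRingHom ℚ)).map φQ := hintQ P'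
  have hmapQ' : (iO Q').map (algebraMap (padicCoeffRing K) K) = (Q'.map (Int.castRingHom ℚ)).map φQ := hintQ Q'
  have hmapP₂' : (iO P₂').map (algebraMap (padicCoeffRing K) K) = (P₂'.map (Int.castRingHom ℚ)).map φQ := hintQ P₂'
  have hmapQ₂' : (iO Q₂').map (algebraMap (padicCoeffRing K) K) = (Q₂'.map (Int.castRingHom ℚ)).map φQ := hintQ Q₂'
  have hPQ'K : t₀K * (Q'.map (Int.castRingHom ℚ)).map φQ = (P'.map (Int.castRingHom ℚ)).map φQ := by
    rw [ht₀K, ← map_mul, hPQ']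
  have hPQ₂'K : PowerSeries.map φQ (W'.formalW.subst t₀) * (Q₂'.map (Int.castRingHom ℚ)).map φQ =
      (P₂'.map (Int.castRingHom ℚ)).map φQ := by
    rw [← map_mul, hPQ₂']
  have hCs : (C s : (padicCoeffRing K)⟦X⟧).map (algebraMap (padicCoeffRing K) K) = C C''.s := by rw [map_C, halgO, hC'']
  have hCr : (C r : (padicCoeffRing K)⟦X⟧).map (algebraMap (padicCoeffRing K) K) = C C''.r := by rw [map_C, halgO, hC'']
  have hCtsr : (C (t - s * r) : (padicCoeffRing K)⟦X⟧).map (algebraMap (padicCoeffRing K) K) = C (C''.t - C''.s * C''.r) := by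
    rw [map_C, map_sub, map_mul, halgO, halgO, halgO, hC'']
  have hCπ : (C (πO ^ k) : (padicCoeffRing K)⟦X⟧).map (algebraMap (padicCoeffRing K) K) = C ((C''.u : Kˣ) : K) := by
    rw [map_C, map_pow, halgO, hπOc, hC'', Units.val_pow_eq_pow_val]
  have hQ''K : Q''.map (algebraMap (padicCoeffRing K) K) =
      (Q'.map (Int.castRingHom ℚ)).map φQ * (Q₂'.map (Int.castRingHom ℚ)).map φQ *
        (1 + C C''.s * t₀K + C (C''.t - C''.s * C''.r) * PowerSeries.map φQ (W'.formalW.subst t₀)) := by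
    rw [hQ'']
    simp only [map_add, map_mul, hmapP', hmapQ', hmapP₂', hmapQ₂', hCs, hCtsr]
    linear_combination (C C''.s * (Q₂'.map (Int.castRingHom ℚ)).map φQ) * hPQ'K.symm +
      (C (C''.t - C''.s * C''.r) * (Q'.map (Int.castRingHom ℚ)).map φQ) * hPQ₂'K.symm
  have hP''K : P''.map (algebraMap (padicCoeffRing K) K) =
      C ((C''.u : Kˣ) : K) * ((P'.map (Int.castRingHom ℚ)).map φQ * (Q₂'.map (Int.castRingHom ℚ)).map φQ -
        C C''.r * (Q'.map (Int.castRingHom ℚ)).map φQ * (P₂'.map (Int.castRingHom ℚ)).map φQ) := by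
    rw [hP'']
    simp only [map_mul, map_sub, hmapP', hmapQ', hmapP₂', hmapQ₂', hCr, hCπ]
  have hQ''0 : Q'' ≠ 0 := by
    intro h0
    have h0' := congrArg (PowerSeries.map (algebraMap (padicCoeffRing K) K)) h0
    rw [map_zero, hQ''K] at h0'
    have hQ'0 : (Q'.map (Int.castRingHom ℚ)).map φQ ≠ 0 := by
      intro h
      apply hQ'
      apply PowerSeries.map_injective (Int.castRingHom ℚ) Int.cast_injective
      apply PowerSeries.map_injective φQ φQ.injective
      rw [h, map_zero, map_zero]
    have hQ₂'0 : (Q₂'.map (Int.castRingHom ℚ)).map φQ ≠ 0 := by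
      intro h
      apply hQ₂'
      apply PowerSeries.map_injective (Int.castRingHom ℚ) Int.cast_injective
      apply PowerSeries.map_injective φQ φQ.injective
      rw [h, map_zero, map_zero]
    have hden0 : (1 + C C''.s * t₀K + C (C''.t - C''.s * C''.r) * PowerSeries.map φQ (W'.formalW.subst t₀)) ≠ 0 := by
      intro h
      have h1 := congrArg constantCoeff h
      have hw0 : constantCoeff (PowerSeries.map φQ (W'.formalW.subst t₀)) = 0 := by
        rw [← coeff_zero_eq_constantCoeff, coeff_map, coeff_zero_eq_constantCoeff,
          constantCoeff_subst_eq_constantCoeff ht₀0, W'.constantCoeff_formalW, map_zero]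
      rw [map_add, map_add, map_mul, map_mul, ht₀K0, hw0] at h1
      simp at h1
    exact (mul_ne_zero (mul_ne_zero hQ'0 hQ₂'0) hden0) h0'
  have hPQ'' : t'' * Q''.map (algebraMap (padicCoeffRing K) K) = P''.map (algebraMap (padicCoeffRing K) K) := by
    rw [hQ''K, hP''K]
    linear_combination ((Q'.map (Int.castRingHom ℚ)).map φQ * (Q₂'.map (Int.castRingHom ℚ)).map φQ) * keyK +
      (C ((C''.u : Kˣ) : K) * (Q₂'.map (Int.castRingHom ℚ)).map φQ) * hPQ'K -
      (C ((C''.u : Kˣ) : K) * C C''.r * (Q'.map (Int.castRingHom ℚ)).map φQ) * hPQ₂'K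
  /- Step 7: the Honda witness over `K` and `(padicCoeffRing K)`; `u = n₁ / d`; `[d]_{W''}(t'') = [n₁]_{W''}(x)`,
  `x = θ(ψ)`, an `(padicCoeffRing K)`-integral series. -/
  obtain ⟨ψ, hψ0, hψi, hψ⟩ := hψex
  have hψs : HasSubst ψ := HasSubst.of_constantCoeff_zero' hψ0
  obtain ⟨ψ₁, hψ₁⟩ := isPadicInt_iff_exists_powerSeries_map.mp (isPadicInt_iff_coeff.mpr hψi)
  set ψK : K⟦X⟧ := ψ.map φK with hψK
  have hψK0 : constantCoeff ψK = 0 := by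
    rw [hψK, ← coeff_zero_eq_constantCoeff, coeff_map, coeff_zero_eq_constantCoeff, hψ0, map_zero]
  have hψKs : HasSubst ψK := HasSubst.of_constantCoeff_zero' hψK0
  have hψOK : (ψ₁.map ι).map (algebraMap (padicCoeffRing K) K) = ψK := by
    rw [hmm]; exact congrArg (PowerSeries.map φK) hψ₁
  have hWKp : (W'.map φ).map φK = WK := by rw [hWK, map_map, hcomp]
  have hℓ'' : (PowerSeries.mk fun n ↦ ((W'.LFunction n : ℤ) : ℚ_[p]) / n).map φK = ℓK := by
    ext n; rw [coeff_map, coeff_mk, hℓK, coeff_mk, map_div₀, map_natCast, map_intCast]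
  have hlogψK : WK.formalLog.subst ψK = ℓK := by
    rw [hψK, ← hWKp, ← (W'.map φ).map_formalLog φK, ← powerSeries_map_subst hψs φK, hψ, hℓ'']
  set x : K⟦X⟧ := θ.subst ψK with hx
  have hx0 : constantCoeff x = 0 := (constantCoeff_subst_eq_constantCoeff hψK0).trans hθ0
  have hxs : HasSubst x := HasSubst.of_constantCoeff_zero' hx0
  have hxO : PowerSeries.map (algebraMap (padicCoeffRing K) K) (θ₀.subst (ψ₁.map ι)) = x := by
    rw [powerSeries_map_subst (HasSubst.of_constantCoeff_zero' (by
      rw [← coeff_zero_eq_constantCoeff, coeff_map, coeff_zero_eq_constantCoeff]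
      have h := hψ0
      rw [← hψ₁, ← coeff_zero_eq_constantCoeff, coeff_map, coeff_zero_eq_constantCoeff] at h
      rw [PadicInt.coe_eq_zero.mp h, map_zero])) (algebraMap (padicCoeffRing K) K), hθ₀, hψOK, hx, hθ]
  have hlogx : W''.formalLog.subst x = C ((πu : K) ^ k) * ℓK := by
    rw [hx, hW'', hθ, WK.formalLog_subst_formalVariableChange_subst C'' hψK0, hlogψK, hC'',
      Units.val_pow_eq_pow_val]
  -- `u = n₁ / d`
  set d : ℕ := u.den with hd
  have hd0 : 0 < d := u.den_pos
  have hnum : 0 < u.num := Rat.num_pos.mpr hCpos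
  set n₁ : ℕ := u.num.toNat with hn₁
  have hn₁z : ((n₁ : ℕ) : ℤ) = u.num := Int.toNat_of_nonneg hnum.le
  have hdu : (d : K) * φQ u = (n₁ : K) := by
    have h : (u) * d = (u.num : ℚ) := Rat.mul_den_eq_num _
    rw [← hn₁z] at h
    have h' := congrArg φQ h
    rw [map_mul, map_natCast, Int.cast_natCast, map_natCast] at h'
    rw [mul_comm]
    exact h'
  set wK : K⟦X⟧ := (W''.formalMul n₁).subst x with hwK'
  have hwK0 : constantCoeff wK = 0 :=
    (constantCoeff_subst_eq_constantCoeff hx0).trans (W''.constantCoeff_formalMul n₁)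
  have hlogw : W''.formalLog.subst wK = n₁ • (C ((πu : K) ^ k) * ℓK) := by
    rw [hwK', ← subst_comp_subst_apply (W''.hasSubst_formalMul n₁) hxs, W''.formalLog_subst_formalMul_rat n₁,
      ← coe_substAlgHom hxs, map_nsmul, coe_substAlgHom, hlogx]
  have hdt''0 : constantCoeff ((W''.formalMul d).subst t'') = 0 :=
    (constantCoeff_subst_eq_constantCoeff ht''0).trans (W''.constantCoeff_formalMul d)
  have hlogd : W''.formalLog.subst ((W''.formalMul d).subst t'') = n₁ • (C ((πu : K) ^ k) * ℓK) := by
    rw [← subst_comp_subst_apply (W''.hasSubst_formalMul d) ht''s, W''.formalLog_subst_formalMul_rat d,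
      ← coe_substAlgHom ht''s, map_nsmul, coe_substAlgHom, hlog'', nsmul_eq_mul, nsmul_eq_mul,
      ← map_natCast (C : K →+* K⟦X⟧) d, ← map_natCast (C : K →+* K⟦X⟧) n₁, ← hdu, map_mul]
    ring
  have hGw : (W''.formalMul d).subst t'' = wK :=
    W''.eq_of_formalLog_subst_eq hdt''0 hwK0 (hlogd.trans hlogw.symm)
  -- `[d]_{V''}(t'') = w''`, `w'' = [n₁]_{V''}(θ₀(ψ)) ∈ (padicCoeffRing K)⟦X⟧`
  set w'' : (padicCoeffRing K)⟦X⟧ := (V''.formalMul n₁).subst (θ₀.subst (ψ₁.map ι)) with hw''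
  have hψ₁ιs : HasSubst (θ₀.subst (ψ₁.map ι)) := by
    refine HasSubst.of_constantCoeff_zero' ((constantCoeff_subst_eq_constantCoeff ?_).trans hθ₀0)
    rw [← coeff_zero_eq_constantCoeff, coeff_map, coeff_zero_eq_constantCoeff]
    have h := hψ0
    rw [← hψ₁, ← coeff_zero_eq_constantCoeff, coeff_map, coeff_zero_eq_constantCoeff] at h
    rw [PadicInt.coe_eq_zero.mp h, map_zero]
  have hGz : (V''.formalMul d).subst t'' = w''.map (algebraMap (padicCoeffRing K) K) := by
    rw [← subst_map_algebraMap (V''.formalMul d) ht''s, map_formalMul, hV''K, hGw, hw'',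
      powerSeries_map_subst hψ₁ιs (algebraMap (padicCoeffRing K) K), map_formalMul, hV''K, hxO]
  /- Step 8: finite height of `V'' ⊗ k_K`: a unit coefficient of `[d]_{V''}` in positive degree. -/
  obtain ⟨nn, hnn, hunit⟩ : ∃ nn : ℕ, 0 < nn ∧ IsUnit (coeff nn (V''.formalMul d)) := by
    have hP : (V''.map (residue (padicCoeffRing K))).formalMul p ≠ 0 := by
      rw [← map_formalMul]
      intro h0'
      have h := congrArg (coeff J) h0'
      rw [coeff_map, map_zero] at h
      exact (residue_ne_zero_iff_isUnit _ |>.mpr hJu) h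
    have hD : (V''.map (residue (padicCoeffRing K))).formalMul d ≠ 0 :=
      (V''.map (residue (padicCoeffRing K))).formalMul_ne_zero_of_formalMul_prime_ne_zero hP hd0
    obtain ⟨nn, hnn⟩ := exists_coeff_ne_zero_iff_ne_zero.mpr hD
    rw [← map_formalMul, coeff_map] at hnn
    refine ⟨nn, Nat.pos_of_ne_zero ?_, ?_⟩
    · rintro rfl
      apply hnn
      rw [coeff_zero_eq_constantCoeff_apply, V''.constantCoeff_formalMul d, map_zero]
    · by_contra hu
      apply hnn
      exact (residue_eq_zero_iff _).mpr ((IsLocalRing.mem_maximalIdeal _).mpr hu)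
  /- Step 9: the local lemma over `(padicCoeffRing K)`, and `‖u‖ ≤ 1`. -/
  obtain ⟨t₃, ht₃⟩ := Literature.RingTheory.PowerSeries.exists_map_eq_of_subst_eq_map (O := padicCoeffRing K) (L := K)
    hinjO hnn hunit ht''0 hGz hQ''0 hPQ''
  have h1 : algebraMap (padicCoeffRing K) K (coeff 1 t₃) = (πu : K) ^ k * φQ u := by
    rw [← ht''1, ← ht₃, coeff_map]
  have hφQu : φQ u = φK ((u : ℚ) : ℚ_[p]) := by
    rw [← hcomp, RingHom.comp_apply, hφ, eq_ratCast]
  refine ⟨t₃, ?_, h1, ?_⟩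
  · apply hinjO
    rw [map_zero, ← coeff_zero_eq_constantCoeff_apply, ← coeff_map, ht₃,
      coeff_zero_eq_constantCoeff_apply, ht''0]
  · rw [hV''K, ht₃, hlog'', ← mul_assoc, ← map_mul]

set_option maxHeartbeats 4000000 in
/-- **The sharp ender (Step 10).** Let `K/ℚ_p` be finite, `O = 𝒪_K`, `π ∈ Kˣ` with
`‖π‖ᵉ = p⁻¹`, `V''` an `O`-curve with a unit coefficient of `[p]_{V''}` in some degree `J ≥ 1`
(finite height) and `‖b_j‖ ≥ ‖π‖ᵛ` for its coefficient in a degree `j ≥ 1` with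
`(j - 1)k + v < je` (a vertex of the Newton polygon of `[p]_{V''}`; `j = J`, `v = 0` allowed); let `a : ℕ → ℤ` with `a 1 = 1` and `ℓ = Σ aₙXⁿ/n` `p`-integral, `u ∈ ℚˣ`, and
`t₃ ∈ XO⟦X⟧` with `[X¹]t₃ = πᵏu`, `log_{V''}(t₃) = πᵏu·ℓ`. Then `‖u‖_p ≤ 1`: the series
`Φ = t₃ ∘ ℓ⁻¹ ∈ O⟦X⟧` (`ℓ⁻¹ ∈ ℤ_p⟦X⟧`, `PowerSeries.substInvOfIsUnit`) has `log_{V''} Φ = πᵏu·X`,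
so `[p]_{V''}(Φ) = Φ(pX)`, and `norm_coeff_mul_pow_le_of_subst_eq_rescale` with
`exists_index_norm_coeff_max` gives `‖b_j‖ ‖πᵏu‖^{j-1} ≤ p⁻¹`; conclude by
`Padic.norm_le_one_of_pow_mul_pow_mul_norm_pow_le`. [folklore] -/
theorem padicNorm_le_one_of_integral_param {p : ℕ} [Fact p.Prime]
    (K : IntermediateField ℚ_[p] (PadicAlgCl p)) [FiniteDimensional ℚ_[p] K]
    (πu : Kˣ) {e k J : ℕ} (hπe : ‖((πu : K) : PadicAlgCl p)‖ ^ e = (p : ℝ)⁻¹) (hJ : 0 < J)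
    {u : ℚ} (hu : u ≠ 0) (a : ℕ → ℤ) (ha1 : a 1 = 1)
    (hℓint : ∀ n, ‖coeff n (PowerSeries.mk fun n ↦ ((a n : ℤ) : ℚ_[p]) / n)‖ ≤ 1)
    (V'' : WeierstrassCurve (padicCoeffRing K)) (hJu : IsUnit (coeff J (V''.formalMul p)))
    {j v : ℕ} (hj : 1 ≤ j)
    (hbj : ‖((πu : K) : PadicAlgCl p)‖ ^ v ≤
      ‖(((coeff j (V''.formalMul p) : padicCoeffRing K) : K) : PadicAlgCl p)‖)
    (hjke : (j - 1) * k + v < j * e)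
    (t₃ : (padicCoeffRing K)⟦X⟧) (ht₃0 : constantCoeff t₃ = 0)
    (h1 : algebraMap (padicCoeffRing K) K (coeff 1 t₃) = (πu : K) ^ k * algebraMap ℚ K u)
    (hlog : (V''.map (algebraMap (padicCoeffRing K) K)).formalLog.subst
        (t₃.map (algebraMap (padicCoeffRing K) K)) =
      C ((πu : K) ^ k * algebraMap ℚ K u) * PowerSeries.mk fun n ↦ ((a n : ℤ) : K) / n) :
    ‖((u : ℚ) : ℚ_[p])‖ ≤ 1 := by
  letI hOloc : IsLocalRing (padicCoeffRing K) := isLocalRing_padicCoeffRing K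
  have hp1R : (1 : ℝ) < p := by exact_mod_cast (Fact.out : p.Prime).one_lt
  set π : PadicAlgCl p := ((πu : K) : PadicAlgCl p) with hπdef
  set ι : ℤ_[p] →+* (padicCoeffRing K) := padicIntToCoeffRing K with hιdef
  set φK : ℚ_[p] →+* K := algebraMap ℚ_[p] K with hφK
  set φ : ℚ →+* ℚ_[p] := algebraMap ℚ ℚ_[p] with hφ
  set φQ : ℚ →+* K := algebraMap ℚ K with hφQ
  have halgO : ∀ y : (padicCoeffRing K), algebraMap (padicCoeffRing K) K y = (y : K) := fun y ↦ rfl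
  have hinjO : Function.Injective (algebraMap (padicCoeffRing K) K) := fun x y h ↦ Subtype.ext h
  have hιφ : ∀ x : ℤ_[p], algebraMap (padicCoeffRing K) K (ι x) = φK (x : ℚ_[p]) := fun x ↦ rfl
  have hcomp : φK.comp φ = φQ := RingHom.ext fun x ↦ by
    rw [eq_ratCast (φK.comp φ) x, eq_ratCast φQ x]
  have hmm : ∀ R : ℤ_[p]⟦X⟧, (R.map ι).map (algebraMap (padicCoeffRing K) K) =
      (R.map (algebraMap ℤ_[p] ℚ_[p])).map φK := fun R ↦ by
    ext n
    simp only [coeff_map, hιφ]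
    rfl
  have hφQu : φQ u = φK ((u : ℚ) : ℚ_[p]) := by
    rw [← hcomp, RingHom.comp_apply, hφ, eq_ratCast]
  set W'' : WeierstrassCurve K := V''.map (algebraMap (padicCoeffRing K) K) with hW''
  set ℓK : K⟦X⟧ := PowerSeries.mk fun n ↦ ((a n : ℤ) : K) / n with hℓK
  set t'' : K⟦X⟧ := t₃.map (algebraMap (padicCoeffRing K) K) with ht''
  have ht₃K : t₃.map (algebraMap (padicCoeffRing K) K) = t'' := rfl
  have ht''0 : constantCoeff t'' = 0 := by
    rw [ht'', ← coeff_zero_eq_constantCoeff, coeff_map, coeff_zero_eq_constantCoeff, ht₃0, map_zero]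
  have ht''s : HasSubst t'' := HasSubst.of_constantCoeff_zero' ht''0
  have hlog'' : W''.formalLog.subst t'' = C ((πu : K) ^ k * φQ u) * ℓK := hlog
  have hℓ'' : (PowerSeries.mk fun n ↦ ((a n : ℤ) : ℚ_[p]) / n).map φK = ℓK := by
    ext n; rw [coeff_map, coeff_mk, hℓK, coeff_mk, map_div₀, map_natCast, map_intCast]
  /- Step 10 (the sharp ender): `Φ = t₃ ∘ ℓ⁻¹ ∈ O⟦X⟧` is a homomorphism `𝔾_a → V̂''`,
  `[p]_{V''}(Φ) = Φ(pX)`, and the Newton-polygon bound gives `‖πᵏu‖^{J-1} ≤ ‖p‖`. -/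
  -- `ℓ` over `ℤ_p` and over `O`, and its compositional inverse
  obtain ⟨ℓZ, hℓZ⟩ := isPadicInt_iff_exists_powerSeries_map.mp (isPadicInt_iff_coeff.mpr hℓint)
  set ℓO : (padicCoeffRing K)⟦X⟧ := ℓZ.map ι with hℓO
  have hℓOK : ℓO.map (algebraMap (padicCoeffRing K) K) = ℓK := by
    rw [hℓO, hmm]; exact (congrArg (PowerSeries.map φK) hℓZ).trans hℓ''
  have hℓO0 : constantCoeff ℓO = 0 := by
    apply hinjO
    rw [map_zero, ← coeff_zero_eq_constantCoeff_apply, ← coeff_map, hℓOK, hℓK, coeff_mk,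
      Nat.cast_zero, div_zero]
  have hℓO1 : coeff 1 ℓO = 1 := by
    apply hinjO
    rw [map_one, ← coeff_map, hℓOK, hℓK, coeff_mk, Nat.cast_one, div_one,
      ha1, Int.cast_one]
  have hℓOu : IsUnit (coeff 1 ℓO) := by rw [hℓO1]; exact isUnit_one
  set ℓinv : (padicCoeffRing K)⟦X⟧ := substInvOfIsUnit ℓO hℓOu with hℓinv
  have hℓinv0 : constantCoeff ℓinv = 0 := constantCoeff_substInvOfIsUnit ℓO hℓOu
  have hright : ℓO.subst ℓinv = X := subst_substInvOfIsUnit_right ℓO hℓO0 hℓOu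
  have hleft : ℓinv.subst ℓO = X := subst_substInvOfIsUnit_left ℓO hℓO0 hℓOu
  have hℓinvs : HasSubst ℓinv := HasSubst.of_constantCoeff_zero' hℓinv0
  have hℓinv1 : coeff 1 ℓinv = 1 := by
    have h := congrArg (coeff 1) hleft
    rwa [coeff_one_subst_eq_mul _ hℓO0, hℓO1, mul_one, coeff_one_X] at h
  -- `Φ := t₃ ∘ ℓ⁻¹ ∈ O⟦X⟧`
  set Φ : (padicCoeffRing K)⟦X⟧ := t₃.subst ℓinv with hΦ
  have hΦ0 : constantCoeff Φ = 0 := (constantCoeff_subst_eq_constantCoeff hℓinv0).trans ht₃0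
  have hΦ1 : coeff 1 Φ = coeff 1 t₃ := by
    rw [hΦ, coeff_one_subst_eq_mul _ hℓinv0, hℓinv1, mul_one]
  -- over `K`
  set ℓKinv : K⟦X⟧ := ℓinv.map (algebraMap (padicCoeffRing K) K) with hℓKinv
  have hℓKinv0 : constantCoeff ℓKinv = 0 := by
    rw [hℓKinv, ← coeff_zero_eq_constantCoeff, coeff_map, coeff_zero_eq_constantCoeff, hℓinv0,
      map_zero]
  have hℓKinvs : HasSubst ℓKinv := HasSubst.of_constantCoeff_zero' hℓKinv0
  have hrightK : ℓK.subst ℓKinv = X := by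
    rw [← hℓOK, hℓKinv, ← powerSeries_map_subst hℓinvs (algebraMap (padicCoeffRing K) K), hright,
      map_X]
  set ΦK : K⟦X⟧ := Φ.map (algebraMap (padicCoeffRing K) K) with hΦK
  have hΦKt : ΦK = t''.subst ℓKinv := by
    rw [hΦK, hΦ, powerSeries_map_subst hℓinvs (algebraMap (padicCoeffRing K) K), ht₃K, ← hℓKinv]
  have hΦK0 : constantCoeff ΦK = 0 := by
    rw [hΦKt]; exact (constantCoeff_subst_eq_constantCoeff hℓKinv0).trans ht''0
  have hΦKs : HasSubst ΦK := HasSubst.of_constantCoeff_zero' hΦK0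
  -- `log_{W''}(ΦK) = C(πᵏu) · X`
  have hlogΦ : W''.formalLog.subst ΦK = C ((πu : K) ^ k * φQ u) * X := by
    rw [hΦKt, ← subst_comp_subst_apply ht''s hℓKinvs, hlog'', subst_C_mul' hℓKinvs, hrightK]
  -- the functional equation `[p]_{W''}(ΦK) = ΦK(pX)`
  have hpX0 : constantCoeff ((p : K) • (X : K⟦X⟧)) = 0 := by
    rw [← coeff_zero_eq_constantCoeff_apply, coeff_smul, coeff_zero_X, smul_zero]
  have hpXs : HasSubst ((p : K) • (X : K⟦X⟧)) := HasSubst.of_constantCoeff_zero' hpX0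
  have hfe1 : constantCoeff ((W''.formalMul p).subst ΦK) = 0 :=
    (constantCoeff_subst_eq_constantCoeff hΦK0).trans (W''.constantCoeff_formalMul p)
  have hfe2 : constantCoeff (rescale (p : K) ΦK) = 0 := by
    rw [← coeff_zero_eq_constantCoeff_apply, coeff_rescale, pow_zero, one_mul,
      coeff_zero_eq_constantCoeff_apply, hΦK0]
  have hlog1 : W''.formalLog.subst ((W''.formalMul p).subst ΦK) =
      p • (C ((πu : K) ^ k * φQ u) * X) := by
    rw [← subst_comp_subst_apply (W''.hasSubst_formalMul p) hΦKs, W''.formalLog_subst_formalMul_rat p,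
      ← coe_substAlgHom hΦKs, map_nsmul, coe_substAlgHom, hlogΦ]
  have hlog2 : W''.formalLog.subst (rescale (p : K) ΦK) = p • (C ((πu : K) ^ k * φQ u) * X) := by
    rw [rescale_eq_subst, ← subst_comp_subst_apply hΦKs hpXs, hlogΦ, subst_C_mul' hpXs, subst_X hpXs,
      smul_eq_C_mul, nsmul_eq_mul, ← map_natCast (C : K →+* K⟦X⟧) p]
    ring
  have hfeK : (W''.formalMul p).subst ΦK = rescale (p : K) ΦK :=
    W''.eq_of_formalLog_subst_eq hfe1 hfe2 (hlog1.trans hlog2.symm)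
  -- in `ℚ̄_p`
  set jA : K →+* PadicAlgCl p := algebraMap K (PadicAlgCl p) with hjA
  set ΦA : (PadicAlgCl p)⟦X⟧ := ΦK.map jA with hΦA
  set BA : (PadicAlgCl p)⟦X⟧ := (W''.formalMul p).map jA with hBA
  have hfeA : BA.subst ΦA = rescale (p : PadicAlgCl p) ΦA := by
    rw [hBA, hΦA, ← powerSeries_map_subst hΦKs jA, hfeK]
    ext n
    simp only [coeff_map, coeff_rescale, map_mul, map_pow, map_natCast]
  have hcoefΦ : ∀ n, coeff n ΦA = (((coeff n Φ : padicCoeffRing K) : K) : PadicAlgCl p) := fun n ↦ by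
    rw [hΦA, coeff_map, hΦK, coeff_map]; rfl
  have hBV : W''.formalMul p = (V''.formalMul p).map (algebraMap (padicCoeffRing K) K) := by
    rw [map_formalMul]
  have hcoefB : ∀ n, coeff n BA = (((coeff n (V''.formalMul p) : padicCoeffRing K) : K) : PadicAlgCl p) := fun n ↦ by
    rw [hBA, coeff_map, hBV, coeff_map]; rfl
  -- the hypotheses of the Newton-polygon bound
  have hΦ10 : coeff 1 Φ ≠ 0 := by
    intro h0
    have h2 : algebraMap (padicCoeffRing K) K (coeff 1 t₃) = 0 := by rw [← hΦ1, h0, map_zero]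
    rw [h1] at h2
    exact mul_ne_zero (pow_ne_zero _ (Units.ne_zero πu)) ((map_ne_zero φQ).mpr hu) h2
  obtain ⟨N₁, hN₁0, hN₁max, hN₁low⟩ := exists_index_norm_coeff_max K hΦ10
  have hA0 : constantCoeff ΦA = 0 := by
    rw [← coeff_zero_eq_constantCoeff_apply, hcoefΦ, coeff_zero_eq_constantCoeff_apply, hΦ0]; rfl
  have hA1 : ∀ n, ‖coeff n ΦA‖ ≤ ‖coeff N₁ ΦA‖ := fun n ↦ by
    rw [hcoefΦ, hcoefΦ]; exact hN₁max n
  have hAlow : ∀ n < N₁, ‖coeff n ΦA‖ < ‖coeff N₁ ΦA‖ := fun n hn ↦ by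
    rw [hcoefΦ, hcoefΦ]; exact hN₁low n hn
  have hAne : coeff N₁ ΦA ≠ 0 := by
    rw [hcoefΦ]
    intro h0
    apply hN₁0
    have h0' : ((coeff N₁ Φ : padicCoeffRing K) : K) = 0 := by exact_mod_cast h0
    exact_mod_cast h0'
  have hAM1 : ‖coeff N₁ ΦA‖ ≤ 1 := by rw [hcoefΦ]; exact norm_coe_padicCoeffRing_le K _
  have hB0A : constantCoeff BA = 0 := by
    rw [← coeff_zero_eq_constantCoeff_apply, hcoefB, coeff_zero_eq_constantCoeff_apply,
      V''.constantCoeff_formalMul p]; rfl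
  have hBle : ∀ j, ‖coeff j BA‖ ≤ 1 := fun j ↦ by rw [hcoefB]; exact norm_coe_padicCoeffRing_le K _
  have hBJ : ‖coeff J BA‖ = 1 := by rw [hcoefB]; exact (isUnit_padicCoeffRing_iff K _).mp hJu
  have hpA : ‖(p : PadicAlgCl p)‖ = (p : ℝ)⁻¹ := by
    rw [← map_natCast (algebraMap ℚ_[p] (PadicAlgCl p)) p]
    change ‖((p : ℚ_[p]) : PadicAlgCl p)‖ = (p : ℝ)⁻¹
    rw [PadicAlgCl.norm_extends, Padic.norm_p]
  have key := norm_coeff_mul_pow_le_of_subst_eq_rescale hA0 hA1 hAlow hAne hAM1 hB0A hBle hJ hBJ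
    (by rw [hpA]; exact inv_le_one_of_one_le₀ hp1R.le) hfeA j hj
  rw [hpA] at key
  -- `‖π‖ᵛ M^{j-1} ≤ p⁻¹` and `‖πᵏ u‖ ≤ M`
  have hMpos : 0 < ‖coeff N₁ ΦA‖ := norm_pos_iff.mpr hAne
  have hbj' : ‖π‖ ^ v ≤ ‖coeff j BA‖ := by rw [hcoefB]; exact hbj
  have hMJ : ‖π‖ ^ v * ‖coeff N₁ ΦA‖ ^ (j - 1) ≤ (p : ℝ)⁻¹ := by
    refine le_of_mul_le_mul_right ?_ hMpos
    calc ‖π‖ ^ v * ‖coeff N₁ ΦA‖ ^ (j - 1) * ‖coeff N₁ ΦA‖ = ‖π‖ ^ v * ‖coeff N₁ ΦA‖ ^ j := by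
          rw [mul_assoc, ← pow_succ, Nat.sub_add_cancel hj]
      _ ≤ ‖coeff j BA‖ * ‖coeff N₁ ΦA‖ ^ j :=
          mul_le_mul_of_nonneg_right hbj' (pow_nonneg hMpos.le _)
      _ ≤ (p : ℝ)⁻¹ * ‖coeff N₁ ΦA‖ := key
  have hμ : ‖π‖ ^ k * ‖((u : ℚ) : ℚ_[p])‖ ≤ ‖coeff N₁ ΦA‖ := by
    have h2 := hA1 1
    rw [hcoefΦ 1, hΦ1, ← halgO, h1, hφQu] at h2
    push_cast at h2
    rw [norm_mul, norm_pow, IntermediateField.coe_algebraMap_apply] at h2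
    change ‖π‖ ^ k * ‖(((u : ℚ) : ℚ_[p]) : PadicAlgCl p)‖ ≤ ‖coeff N₁ ΦA‖ at h2
    rwa [PadicAlgCl.norm_extends] at h2
  have hfinal : ‖π‖ ^ v * (‖π‖ ^ k * ‖((u : ℚ) : ℚ_[p])‖) ^ (j - 1) ≤ (p : ℝ)⁻¹ :=
    (mul_le_mul_of_nonneg_left (pow_le_pow_left₀ (by positivity) hμ _)
      (pow_nonneg (norm_nonneg _) _)).trans hMJ
  exact Padic.norm_le_one_of_pow_mul_pow_mul_norm_pow_le (norm_nonneg π) hπe hj hjke hfinal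



/-- **The local step with the Newton-polygon ender at a vertex `(j, v)`.** As
`padicNorm_le_one_of_formalLog_subst_eq_of_semistableTwist`, with `k < e` replaced by: finite
height (a unit coefficient of `[p]_{V''}` in some positive degree) and a coefficient `b_j` of
`[p]_{V''}`, `j ≥ 1`, with `‖b_j‖ ≥ ‖π‖ᵛ` and `(j - 1)k + v < je`; at the price of the
`p`-integrality of `ℓ = Σ aₙ(W')Xⁿ/n` (automatic at an additive prime).
[cite: Honda1970, Thm. 2 (p. 223)] [cite: EdixhovenManin1991, Prop. 2] -/
theorem padicNorm_le_one_of_formalLog_subst_eq_of_semistableTwist_vertex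
    (W' : WeierstrassCurve ℚ) [W'.IsElliptic] [W'.IsGloballyMinimal] {p : ℕ} [Fact p.Prime]
    {u : ℚ} (hCpos : 0 < u) {t₀ : ℚ⟦X⟧} (ht₀0 : constantCoeff t₀ = 0) (ht₀1 : coeff 1 t₀ = u)
    (hlog₀ : W'.formalLog.subst t₀ = C u * PowerSeries.mk fun n ↦ ((W'.LFunction n : ℤ) : ℚ) / n)
    {P' Q' P₂' Q₂' : ℤ⟦X⟧} (hQ' : Q' ≠ 0)
    (hPQ' : t₀ * Q'.map (Int.castRingHom ℚ) = P'.map (Int.castRingHom ℚ)) (hQ₂' : Q₂' ≠ 0)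
    (hPQ₂' : W'.formalW.subst t₀ * Q₂'.map (Int.castRingHom ℚ) = P₂'.map (Int.castRingHom ℚ))
    (hψex : ∃ ψ : ℚ_[p]⟦X⟧, constantCoeff ψ = 0 ∧ (∀ n, ‖coeff n ψ‖ ≤ 1) ∧
      (W'.map (algebraMap ℚ ℚ_[p])).formalLog.subst ψ =
        PowerSeries.mk fun k ↦ ((W'.LFunction k : ℤ) : ℚ_[p]) / k)
    (hℓint : ∀ n, ‖coeff n (PowerSeries.mk fun k ↦ ((W'.LFunction k : ℤ) : ℚ_[p]) / k)‖ ≤ 1)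
    (K : IntermediateField ℚ_[p] (PadicAlgCl p)) [FiniteDimensional ℚ_[p] K]
    (πu : Kˣ) {e k : ℕ} (hπe : ‖((πu : K) : PadicAlgCl p)‖ ^ e = (p : ℝ)⁻¹)
    (r s t : padicCoeffRing K) (V'' : WeierstrassCurve (padicCoeffRing K))
    (hV'' : V''.map (algebraMap (padicCoeffRing K) K) =
      (⟨πu ^ k, (r : K), (s : K), (t : K)⟩ : VariableChange K) • W'.map (algebraMap ℚ K))
    (hfin : ∃ J : ℕ, 0 < J ∧ IsUnit (coeff J (V''.formalMul p))) {j v : ℕ} (hj : 1 ≤ j)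
    (hbj : ‖((πu : K) : PadicAlgCl p)‖ ^ v ≤
      ‖(((coeff j (V''.formalMul p) : padicCoeffRing K) : K) : PadicAlgCl p)‖)
    (hjke : (j - 1) * k + v < j * e) :
    ‖((u : ℚ) : ℚ_[p])‖ ≤ 1 := by
  obtain ⟨J, hJ, hJu⟩ := hfin
  obtain ⟨t₃, ht₃0, h1, hlog⟩ := exists_integral_param_of_semistableTwist W' hCpos ht₀0 ht₀1 hlog₀
    hQ' hPQ' hQ₂' hPQ₂' hψex K πu hπe r s t V'' hV'' ⟨J, hJ, hJu⟩
  exact padicNorm_le_one_of_integral_param K πu hπe hJ hCpos.ne' (fun n ↦ W'.LFunction n)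
    W'.isMultiplicative_LFunction.map_one hℓint V'' hJu hj hbj hjke t₃ ht₃0 h1 hlog

/-- **The local step with the sharp ender.** As
`padicNorm_le_one_of_formalLog_subst_eq_of_semistableTwist`, but with the hypothesis `k < e`
replaced by `(J - 1)k < Je` for a positive degree `J` in which `[p]_{V''}` has a unit
coefficient (`v = 0` in `…_vertex`). [cite: Honda1970, Thm. 2 (p. 223)]
[cite: EdixhovenManin1991, Prop. 2] -/
theorem padicNorm_le_one_of_formalLog_subst_eq_of_semistableTwist_sharp
    (W' : WeierstrassCurve ℚ) [W'.IsElliptic] [W'.IsGloballyMinimal] {p : ℕ} [Fact p.Prime]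
    {u : ℚ} (hCpos : 0 < u) {t₀ : ℚ⟦X⟧} (ht₀0 : constantCoeff t₀ = 0) (ht₀1 : coeff 1 t₀ = u)
    (hlog₀ : W'.formalLog.subst t₀ = C u * PowerSeries.mk fun n ↦ ((W'.LFunction n : ℤ) : ℚ) / n)
    {P' Q' P₂' Q₂' : ℤ⟦X⟧} (hQ' : Q' ≠ 0)
    (hPQ' : t₀ * Q'.map (Int.castRingHom ℚ) = P'.map (Int.castRingHom ℚ)) (hQ₂' : Q₂' ≠ 0)
    (hPQ₂' : W'.formalW.subst t₀ * Q₂'.map (Int.castRingHom ℚ) = P₂'.map (Int.castRingHom ℚ))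
    (hψex : ∃ ψ : ℚ_[p]⟦X⟧, constantCoeff ψ = 0 ∧ (∀ n, ‖coeff n ψ‖ ≤ 1) ∧
      (W'.map (algebraMap ℚ ℚ_[p])).formalLog.subst ψ =
        PowerSeries.mk fun k ↦ ((W'.LFunction k : ℤ) : ℚ_[p]) / k)
    (hℓint : ∀ n, ‖coeff n (PowerSeries.mk fun k ↦ ((W'.LFunction k : ℤ) : ℚ_[p]) / k)‖ ≤ 1)
    (K : IntermediateField ℚ_[p] (PadicAlgCl p)) [FiniteDimensional ℚ_[p] K]
    (πu : Kˣ) {e k : ℕ} (hπe : ‖((πu : K) : PadicAlgCl p)‖ ^ e = (p : ℝ)⁻¹)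
    (r s t : padicCoeffRing K) (V'' : WeierstrassCurve (padicCoeffRing K))
    (hV'' : V''.map (algebraMap (padicCoeffRing K) K) =
      (⟨πu ^ k, (r : K), (s : K), (t : K)⟩ : VariableChange K) • W'.map (algebraMap ℚ K))
    (hfin : ∃ J : ℕ, 0 < J ∧ IsUnit (coeff J (V''.formalMul p)) ∧ (J - 1) * k < J * e) :
    ‖((u : ℚ) : ℚ_[p])‖ ≤ 1 := by
  obtain ⟨J, hJ, hJu, hJke⟩ := hfin
  refine padicNorm_le_one_of_formalLog_subst_eq_of_semistableTwist_vertex W' hCpos ht₀0 ht₀1 hlog₀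
    hQ' hPQ' hQ₂' hPQ₂' hψex hℓint K πu hπe r s t V'' hV'' ⟨J, hJ, hJu⟩ (j := J) (v := 0) hJ ?_
    (by rwa [add_zero])
  rw [pow_zero]
  exact ((isUnit_padicCoeffRing_iff K _).mp hJu).ge

/-- **`‖q‖_p ≤ 1` at an additive prime from a finite-height twist and a vertex `(j, v)` of
`[p]_{V''}` with `(j - 1)k + v < je`.** For the data of
`edixhoven_int_of_neronLattice_eq_smul_periodLattice`, a prime `p ∣ Δ_min(W')`, `p ∣ c₄(W')`, a
finite `K/ℚ_p` with `‖π‖ᵉ = p⁻¹`, `r, s, t ∈ 𝒪_K` and an `𝒪_K`-curve `V''` with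
`V'' ⊗ K = (πᵏ, r, s, t) • (W' ⊗ K)` of finite height, and a coefficient `b_j` of `[p]_{V''}`,
`j ≥ 1`, with `‖b_j‖ ≥ ‖π‖ᵛ`, `(j - 1)k + v < je`: `‖q‖_p ≤ 1`. (The Honda witness and the
`p`-integrality of `Σ aₙXⁿ/n` are free at an additive prime.) [cite: EdixhovenManin1991, Prop. 2]
[cite: Honda1970, Thm. 2 (p. 223)] -/
theorem padicNorm_le_one_of_neronLattice_eq_smul_periodLattice_of_semistableTwist_vertex
    {N : ℕ} [NeZero N]
    {W' : WeierstrassCurve ℚ} [W'.IsElliptic] [W'.IsGloballyMinimal] {f : CuspForm (Gamma0 N) 2}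
    {L' : PeriodPair} (hf : IsNewformOf W' f) (hL' : IsNeronLatticeOf (W'.baseChange ℂ) L')
    {q : ℚ} (hq : ∀ z ∈ periodLattice f, (q : ℂ) * z ∈ L'.lattice)
    (hq' : ∀ z ∈ L'.lattice, ∃ w ∈ periodLattice f, z = q * w)
    {p : ℕ} [Fact p.Prime] (hΔ : (p : ℤ) ∣ minimalDiscriminantInt W')
    (hc₄ : (p : ℤ) ∣ (integralModelInt W').c₄)
    (K : IntermediateField ℚ_[p] (PadicAlgCl p)) [FiniteDimensional ℚ_[p] K]
    (πu : Kˣ) {e k : ℕ} (hπe : ‖((πu : K) : PadicAlgCl p)‖ ^ e = (p : ℝ)⁻¹)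
    (r s t : padicCoeffRing K) (V'' : WeierstrassCurve (padicCoeffRing K))
    (hV'' : V''.map (algebraMap (padicCoeffRing K) K) =
      (⟨πu ^ k, (r : K), (s : K), (t : K)⟩ : VariableChange K) • W'.map (algebraMap ℚ K))
    (hfin : ∃ J : ℕ, 0 < J ∧ IsUnit (coeff J (V''.formalMul p))) {j v : ℕ} (hj : 1 ≤ j)
    (hbj : ‖((πu : K) : PadicAlgCl p)‖ ^ v ≤
      ‖(((coeff j (V''.formalMul p) : padicCoeffRing K) : K) : PadicAlgCl p)‖)
    (hjke : (j - 1) * k + v < j * e) :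
    ‖(q : ℚ_[p])‖ ≤ 1 := by
  obtain ⟨u, hu, hsign, t₀, ht₀0, ht₀1, hlog₀, P', Q', P₂', Q₂', hQ', hPQ', hQ₂', hPQ₂'⟩ :=
    exists_formalParam_of_neronLattice_eq_smul_periodLattice hf hL' hq hq'
  have hnorm : ‖(q : ℚ_[p])‖ = ‖((u : ℚ) : ℚ_[p])‖ := by
    rcases hsign with h | h
    · rw [h]
    · rw [h, Rat.cast_neg, norm_neg]
  rw [hnorm]
  exact padicNorm_le_one_of_formalLog_subst_eq_of_semistableTwist_vertex W' hu ht₀0 ht₀1 hlog₀ hQ'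
    hPQ' hQ₂' hPQ₂' (W'.exists_padicInt_formalLog_subst_eq_lSeriesLog_of_dvd_of_dvd hΔ hc₄)
    (W'.norm_coeff_lSeriesLog_le_one_of_dvd_of_dvd p hΔ hc₄) K πu hπe r s t V'' hV'' hfin hj hbj hjke

/-- **`‖q‖_p ≤ 1` at an additive prime from a finite-height twist with `(J - 1)k < Je`**
(`v = 0` in `…_vertex`: the unit coefficient itself is the vertex; `k < e` is the case of
`ManinConstantSemistableTwistProofs`). With `J = p^h`, `h` the height of `V'' ⊗ k_K`, the
condition reads `k/e < 1 + 1/(p^h - 1)`. [cite: EdixhovenManin1991, Prop. 2]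
[cite: Honda1970, Thm. 2 (p. 223)] -/
theorem padicNorm_le_one_of_neronLattice_eq_smul_periodLattice_of_semistableTwist_sharp
    {N : ℕ} [NeZero N]
    {W' : WeierstrassCurve ℚ} [W'.IsElliptic] [W'.IsGloballyMinimal] {f : CuspForm (Gamma0 N) 2}
    {L' : PeriodPair} (hf : IsNewformOf W' f) (hL' : IsNeronLatticeOf (W'.baseChange ℂ) L')
    {q : ℚ} (hq : ∀ z ∈ periodLattice f, (q : ℂ) * z ∈ L'.lattice)
    (hq' : ∀ z ∈ L'.lattice, ∃ w ∈ periodLattice f, z = q * w)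
    {p : ℕ} [Fact p.Prime] (hΔ : (p : ℤ) ∣ minimalDiscriminantInt W')
    (hc₄ : (p : ℤ) ∣ (integralModelInt W').c₄)
    (K : IntermediateField ℚ_[p] (PadicAlgCl p)) [FiniteDimensional ℚ_[p] K]
    (πu : Kˣ) {e k : ℕ} (hπe : ‖((πu : K) : PadicAlgCl p)‖ ^ e = (p : ℝ)⁻¹)
    (r s t : padicCoeffRing K) (V'' : WeierstrassCurve (padicCoeffRing K))
    (hV'' : V''.map (algebraMap (padicCoeffRing K) K) =
      (⟨πu ^ k, (r : K), (s : K), (t : K)⟩ : VariableChange K) • W'.map (algebraMap ℚ K))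
    (hfin : ∃ J : ℕ, 0 < J ∧ IsUnit (coeff J (V''.formalMul p)) ∧ (J - 1) * k < J * e) :
    ‖(q : ℚ_[p])‖ ≤ 1 := by
  obtain ⟨J, hJ, hJu, hJke⟩ := hfin
  refine padicNorm_le_one_of_neronLattice_eq_smul_periodLattice_of_semistableTwist_vertex hf hL' hq
    hq' hΔ hc₄ K πu hπe r s t V'' hV'' ⟨J, hJ, hJu⟩ (j := J) (v := 0) hJ ?_ (by rwa [add_zero])
  rw [pow_zero]
  exact ((isUnit_padicCoeffRing_iff K _).mp hJu).ge

end Literature.NumberTheory.EllipticCurves
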